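import Mathlib

/-!
# The polar term of the semilocal Weil form on the Connes–Consani trigonometric basis
# (Connes–Consani, *Spectral triples and ζ-cycles*, §2.1, Lemma 2.7 — with a corrected constant)

Source: A. Connes, C. Consani, *Spectral triples and ζ-cycles*, Enseign. Math. 69 (2023) 93–148,
doi:10.4171/lem/1049 = arXiv:2106.01715 [cite: ConnesConsani2023, §2.1.3–§2.1.4]. All page/equation
locators below are to the journal version (Prop. 2.1 p. 103; §2.1.3 basis and Lemma 2.5 p. 107; Lemma 2.6
p. 108–109; §2.1.4 and Lemma 2.7 eq. (2.29) p. 109, eq. (2.30) and proof p. 110) and to the arXiv version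
(§2.1.3–2.1.4, equations (h02)/(h02ev) of the TeX source).

## The printed objects (§2.1.3, p. 107)

For `L > 0` (`L = 2 log λ`) the real orthonormal basis of `L²([−L/2, L/2]) ⊂ L²(ℝ)` is
`ξ_0(x) = L^{-1/2}`, `ξ_n(x) = (−1)^n (2/L)^{1/2} cos(2πnx/L)` for `n > 0` and
`ξ_n(x) = (−1)^n (2/L)^{1/2} sin(2πnx/L)` for `n < 0` (functions vanishing outside `[−L/2, L/2]`);
`φ^*(x) := conj φ(−x)`; `θ = φ₁ * φ₂^*` is the additive convolution `θ(t) = ∫_ℝ φ₁(x) conj φ₂(x − t) dx`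
(Lemma 2.5); `F(x) = θ(log x)` on `ℝ₊^*` and `F̂(s) = ∫ F(u) u^{-is} d^*u`, so that
`F̂(i/2) + F̂(−i/2) = ∫_{ℝ₊^*} F(x)(x^{1/2} + x^{-1/2}) d^*x = ∫_ℝ θ(t)(e^{t/2} + e^{-t/2}) dt`
(first displayed line of the proof of Lemma 2.7, p. 110) — the POLAR TERM `w_{0,2}` of the matrix of the
Weil sesquilinear form in the basis `η_n = ξ_n ∘ log` (§2.1.4).

## What is proved here (everything; this file introduces no unproved fact)

* `SemilocalTrigBasis.polar_convolution` — the mechanism of Prop. 2.1 / route "Fubini": for the weight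
  `e^{ct}`, `∫ (φ ⋆ g)(t) e^{ct} dt = (∫ φ e^{cx} dx)(∫ g e^{cx} dx)` (the weight is a character, so it
  distributes over the convolution), and `∫ φ^*(x) e^{cx} dx = ∫ φ(x) e^{-cx} dx`.
* closed forms of the moments `a_n^{(c)} = ∫ ξ_n(x) e^{cx} dx` for `c = ± 1/2` and all `n ∈ ℤ`
  (`moment_zero`, `moment_pos`, `moment_neg`), from the explicit antiderivatives of `e^{cx} cos(bx)`,
  `e^{cx} sin(bx)`;
* `SemilocalTrigBasis.hatPolarSum_comp_log` — the change of variables `x = e^t`: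
  `∫_{ℝ₊^*} θ(log x)(x^{1/2} + x^{-1/2}) d^*x = ∫_ℝ θ(t)(e^{t/2} + e^{-t/2}) dt`;
* **Lemma 2.7, even case, CORRECTED** (`lemma27_even`): for integers `n, m > 0` and `θ = ξ_m * ξ_n^*`,
  `F̂(i/2) + F̂(−i/2) = 16 e^{-L/2}(e^{L/2} − 1)² L³ / ((L² + 16π²m²)(L² + 16π²n²))`;
* **Lemma 2.7, odd case, as printed** (`lemma27_odd`): for `n, m < 0`,
  `F̂(i/2) + F̂(−i/2) = −256 π² L e^{-L/2}(e^{L/2} − 1)² m n / ((L² + 16π²m²)(L² + 16π²n²))`;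
* the rank-one normal forms of the whole even (`n, m ≥ 0`, including the constant mode `ξ_0`) and odd
  polar blocks (`polarSum_even_rankOne`, `polarSum_odd_rankOne`).
* **Lemma 2.5 (i) and the EVEN table of Lemma 2.6 (iii)** (§8: `conv_xi_eq_intervalIntegral`, `conv_even_zero_zero`,
  `conv_even_pos_zero`, `conv_even_zero_pos`, `conv_even_pos_pos_ne`, `conv_even_diag`, `conv_even_table`): for
  `0 ≤ y ≤ L` and `n, m ≥ 0` the convolution `(ξ_m * ξ_n^*)(y)` IS the printed table entry — stated in
  `conv_even_table` with exactly the case structure of the tree's table-defined test functions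
  `PfPersistence.thetaEven L n m y` / `ConnesX13.thetaEven`, which are thereby identified with the paper's
  convolutions on `[0, L]`.
* **Lemma 2.5 (ii)–(iii), Lemma 2.6 (ii) and the ODD table of Lemma 2.6 (iii)** (§9: `conv_adj_neg`,
  `conv_adj_add_eq_zero_of_even_odd`, `conv_even_odd_symm_eq_zero` — the splitting `σ = σ^+ ⊕ σ^-` —,
  `conv_odd_ne`, `conv_odd_diag`, `conv_odd_table` with the case structure of the tree's `PfPersistence.thetaOdd`).

## ERRATUM (kernel-checked below: `lemma27_even_eq_two_mul_printed`)

The printed even-case constant is `8`: eq. (2.29) of the journal version (p. 109) and (h02) of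
arXiv:2106.01715 v1–v3 read `F̂(i/2) + F̂(−i/2) = 8 e^{-L/2}(e^{L/2} − 1)² L³ / ((L²+16π²m²)(L²+16π²n²))`.
The correct constant is `16`, off and on the diagonal `n = m`. The odd formula (2.30)/(h02ev) is correct
as printed, and so are the table of Lemma 2.6 (iii), both auxiliary integrals displayed in the proof and the
displayed computation itself — which is the computation of the ODD case (it starts from
`θ(t) + θ(−t) = (2/((m² − n²)π))(m sin(2πnt/L) − n sin(2πmt/L))`, twice the `m, n < 0` row of the table;
the journal version labels it, correctly, "the proof of (2.30)", the arXiv version "the proof of (h02)").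
Carrying out "the similar manner" with the `m, n > 0` rows gives `16`.  Consequently the even polar block
is `w_{0,2}^+ = +2 c_e c_eᵀ` with `(c_e)_n = a_n^{(1/2)}` — the normal form used (correctly) in the
Connes–Consani–Moscovici computations and, in this tree, in
`Summit.RiemannHypothesis.RiemannHypothesis.Theorems.PfPersistence.PolarRankOne.W02_thetaEven`
(`W02 L (thetaEven L n m) = ρ(L) g_n g_m`, `ρ(L) = 2(cosh(L/2) − 1)/L`, `g_0 = 2√2`,
`g_n = 1/(1/4 + (2πn/L)²)`), whose right-hand side is literally the right-hand side of
`polarSum_even_rankOne` below: the table-based polar block of the tree and the convolution-based polar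
term of the paper agree entry by entry, and both are twice the printed (2.29).
Printed corroboration of the corrected value: the later paper Connes–Consani–Moscovici, *Zeta spectral triples*
(arXiv:2511.22755; EMS Ser. Lect. Math. 37 (2026)) [cite: ConnesConsaniMoscovici2026, Lemma 4.1 eq. (4.2)] computes
the same polar matrix in the basis `V_n = κ(U_n)`: `W_{0,2}(V_n, V_m) = 32 L sinh²(L/4)(L² − 16π²mn)/((L²+16π²m²)(L²+16π²n²))`
("a rank two matrix"); since `η_n = (V_n + V_{−n})/√2` for `n > 0` (the phase `(−1)^n` of `ξ_n` is `e^{iπn}` from the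
shift `y = x + L/2`), one checks that this gives `W_{0,2}(η_n, η_m) = 64 L³ sinh²(L/4)/((L²+16π²m²)(L²+16π²n²))
= 16 e^{-L/2}(e^{L/2} − 1)² L³/(…)` — the constant `16` — and, with `η_{−n} = (V_n − V_{−n})/(√2 i)` up to sign, the
printed odd value (2.30).  So the misprint is confined to the displayed constant of (2.29)/(h02).
History of the finding: detected numerically (quadrature ratio 2.0000002) and settled symbolically by the
rh-door construction census, reader t1-r5 (2026-08-20, `LEMMA27-EXACT.md`: three routes, sympy + 40-digit
quadrature); this file is the kernel-checked version of its "route A".  Nothing in this file concerns the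
Riemann hypothesis: these are closed-form integrals of trigonometric functions against `e^{±x/2}`.
-/

noncomputable section

open Real MeasureTheory Set intervalIntegral
open scoped Convolution

namespace Literature.NumberTheory.LFunctions

namespace SemilocalTrigBasis

/-! ## §1 The objects -/

/-- The formula of the basis function `ξ_n` before truncation to `[−L/2, L/2]`: `L^{-1/2}` (`n = 0`),
`(−1)^n (2/L)^{1/2} cos(2πnx/L)` (`n > 0`), `(−1)^n (2/L)^{1/2} sin(2πnx/L)` (`n < 0`).
[cite: ConnesConsani2023, §2.1.3 (basis), p. 107] -/
def xiCore (L : ℝ) (n : ℤ) (x : ℝ) : ℝ :=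
  if n = 0 then 1 / Real.sqrt L
  else if 0 < n then (-1 : ℝ) ^ n * Real.sqrt (2 / L) * Real.cos (2 * π * n * x / L)
  else (-1 : ℝ) ^ n * Real.sqrt (2 / L) * Real.sin (2 * π * n * x / L)

/-- The Connes–Consani real orthonormal basis `ξ_n`, `n ∈ ℤ`, of `L²([−L/2, L/2])`, viewed in `L²(ℝ)`
(extended by `0` outside `[−L/2, L/2]`): `ξ_0 = L^{-1/2}`, `ξ_n = (−1)^n (2/L)^{1/2} cos(2πnx/L)` (`n > 0`),
`ξ_n = (−1)^n (2/L)^{1/2} sin(2πnx/L)` (`n < 0`). [cite: ConnesConsani2023, §2.1.3 (basis), p. 107] -/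
def xi (L : ℝ) (n : ℤ) : ℝ → ℝ :=
  (Icc (-(L / 2)) (L / 2)).indicator (xiCore L n)

/-- The involution `φ ↦ φ^*`, `φ^*(x) = conj φ(−x)`, for REAL-valued `φ` (so `φ^*(x) = φ(−x)`).
[cite: ConnesConsani2023, Lemma 2.5, p. 107] -/
def adj (φ : ℝ → ℝ) : ℝ → ℝ := fun x => φ (-x)

/-- The exponential moment `P_c(θ) = ∫_ℝ θ(t) e^{ct} dt`; for `F = θ ∘ log` one has `F̂(i/2) = P_{1/2}(θ)` and
`F̂(−i/2) = P_{−1/2}(θ)` (`F̂(s) = ∫ F(u) u^{-is} d^*u`, substitution `u = e^t`). [cite: ConnesConsani2023, proof of Prop. 2.1 (p. 103) and of Lemma 2.7 (p. 110)] -/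
def polar (c : ℝ) (θ : ℝ → ℝ) : ℝ := ∫ t, θ t * Real.exp (c * t)

/-- The polar functional of Lemma 2.7 in additive form: `∫_ℝ θ(t)(e^{t/2} + e^{-t/2}) dt` (`= F̂(i/2) + F̂(−i/2)`
for `F = θ ∘ log`, see `hatPolarSum_comp_log`). [cite: ConnesConsani2023, proof of Lemma 2.7, first display, p. 110] -/
def polarSum (θ : ℝ → ℝ) : ℝ := ∫ t, θ t * (Real.exp (t / 2) + Real.exp (-(t / 2)))

/-- The same functional in the paper's multiplicative form: `∫_{ℝ₊^*} F(x) (x^{1/2} + x^{-1/2}) d^*x` with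
`d^*x = dx/x`. [cite: ConnesConsani2023, proof of Lemma 2.7, first display, p. 110] -/
def hatPolarSum (F : ℝ → ℝ) : ℝ := ∫ x in Ioi (0 : ℝ), F x * (x ^ (1 / 2 : ℝ) + x ^ (-(1 / 2) : ℝ)) / x

/-- The moments `a_n^{(c)} = ∫_ℝ ξ_n(x) e^{cx} dx = ∫_{−L/2}^{L/2} ξ_n(x) e^{cx} dx`. [folklore] -/
def moment (L c : ℝ) (n : ℤ) : ℝ := polar c (xi L n)

/-! ## §2 Elementary calculus: `∫ e^{cx} cos(bx)`, `∫ e^{cx} sin(bx)` -/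

/-- PROVED: antiderivative of `e^{cx} cos(bx)`. [folklore] -/
private theorem hasDerivAt_exp_mul_cos_antideriv (c b x : ℝ) (h : c ^ 2 + b ^ 2 ≠ 0) :
    HasDerivAt (fun x => Real.exp (c * x) * (c * Real.cos (b * x) + b * Real.sin (b * x)) / (c ^ 2 + b ^ 2))
      (Real.exp (c * x) * Real.cos (b * x)) x := by
  have h1 : HasDerivAt (fun y : ℝ => c * y) c x := by simpa using (hasDerivAt_id x).const_mul c
  have h2 : HasDerivAt (fun y : ℝ => b * y) b x := by simpa using (hasDerivAt_id x).const_mul b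
  have h5 := ((h1.exp).mul ((h2.cos.const_mul c).add (h2.sin.const_mul b))).div_const (c ^ 2 + b ^ 2)
  refine h5.congr_deriv ?_
  simp only [Pi.add_apply]
  field_simp
  ring

/-- PROVED: antiderivative of `e^{cx} sin(bx)`. [folklore] -/
private theorem hasDerivAt_exp_mul_sin_antideriv (c b x : ℝ) (h : c ^ 2 + b ^ 2 ≠ 0) :
    HasDerivAt (fun x => Real.exp (c * x) * (c * Real.sin (b * x) - b * Real.cos (b * x)) / (c ^ 2 + b ^ 2))
      (Real.exp (c * x) * Real.sin (b * x)) x := by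
  have h1 : HasDerivAt (fun y : ℝ => c * y) c x := by simpa using (hasDerivAt_id x).const_mul c
  have h2 : HasDerivAt (fun y : ℝ => b * y) b x := by simpa using (hasDerivAt_id x).const_mul b
  have h5 := ((h1.exp).mul ((h2.sin.const_mul c).sub (h2.cos.const_mul b))).div_const (c ^ 2 + b ^ 2)
  refine h5.congr_deriv ?_
  simp only [Pi.sub_apply]
  field_simp
  ring

/-- PROVED: `∫_{x₁}^{x₂} e^{cx} cos(bx) dx = [e^{cx}(c cos bx + b sin bx)/(c² + b²)]_{x₁}^{x₂}`. [folklore] -/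
private theorem integral_exp_mul_cos (c b x₁ x₂ : ℝ) (h : c ^ 2 + b ^ 2 ≠ 0) :
    ∫ x in x₁..x₂, Real.exp (c * x) * Real.cos (b * x) =
      Real.exp (c * x₂) * (c * Real.cos (b * x₂) + b * Real.sin (b * x₂)) / (c ^ 2 + b ^ 2) -
      Real.exp (c * x₁) * (c * Real.cos (b * x₁) + b * Real.sin (b * x₁)) / (c ^ 2 + b ^ 2) := by
  apply integral_eq_sub_of_hasDerivAt
  · intro x _
    exact hasDerivAt_exp_mul_cos_antideriv c b x h
  · apply Continuous.intervalIntegrable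
    fun_prop

/-- PROVED: `∫_{x₁}^{x₂} e^{cx} sin(bx) dx = [e^{cx}(c sin bx − b cos bx)/(c² + b²)]_{x₁}^{x₂}`. [folklore] -/
private theorem integral_exp_mul_sin (c b x₁ x₂ : ℝ) (h : c ^ 2 + b ^ 2 ≠ 0) :
    ∫ x in x₁..x₂, Real.exp (c * x) * Real.sin (b * x) =
      Real.exp (c * x₂) * (c * Real.sin (b * x₂) - b * Real.cos (b * x₂)) / (c ^ 2 + b ^ 2) -
      Real.exp (c * x₁) * (c * Real.sin (b * x₁) - b * Real.cos (b * x₁)) / (c ^ 2 + b ^ 2) := by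
  apply integral_eq_sub_of_hasDerivAt
  · intro x _
    exact hasDerivAt_exp_mul_sin_antideriv c b x h
  · apply Continuous.intervalIntegrable
    fun_prop

/-- PROVED: the window integral `∫_{−L/2}^{L/2} e^{cx} cos(2πnx/L) dx = (−1)^n c (e^{cL/2} − e^{−cL/2})/(c² + (2πn/L)²)`
for `n ∈ ℤ` (endpoint values `cos(±nπ) = (−1)^n`, `sin(±nπ) = 0`). [folklore] -/
private theorem integral_exp_mul_cos_window {L : ℝ} (hL : L ≠ 0) (n : ℤ) (c : ℝ)
    (h : c ^ 2 + (2 * π * n / L) ^ 2 ≠ 0) :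
    ∫ x in (-(L / 2))..(L / 2), Real.exp (c * x) * Real.cos (2 * π * n * x / L) =
      (-1 : ℝ) ^ n * (c * (Real.exp (c * (L / 2)) - Real.exp (-(c * (L / 2))))) /
        (c ^ 2 + (2 * π * n / L) ^ 2) := by
  have hb : ∀ x, Real.cos (2 * π * n * x / L) = Real.cos (2 * π * n / L * x) := fun x => by
    congr 1; ring
  simp_rw [hb]
  rw [integral_exp_mul_cos c (2 * π * n / L) _ _ h]
  have e1 : 2 * π * n / L * (L / 2) = n * π := by field_simp
  have e2 : 2 * π * n / L * (-(L / 2)) = -(n * π) := by rw [mul_neg, e1]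
  rw [e1, e2, Real.cos_neg, Real.sin_neg, Real.cos_int_mul_pi, Real.sin_int_mul_pi,
    show c * (-(L / 2)) = -(c * (L / 2)) by ring]
  ring

/-- PROVED: the window integral `∫_{−L/2}^{L/2} e^{cx} sin(2πnx/L) dx = −(−1)^n (2πn/L)(e^{cL/2} − e^{−cL/2})/(c² + (2πn/L)²)`.
[folklore] -/
private theorem integral_exp_mul_sin_window {L : ℝ} (hL : L ≠ 0) (n : ℤ) (c : ℝ)
    (h : c ^ 2 + (2 * π * n / L) ^ 2 ≠ 0) :
    ∫ x in (-(L / 2))..(L / 2), Real.exp (c * x) * Real.sin (2 * π * n * x / L) =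
      -((-1 : ℝ) ^ n * ((2 * π * n / L) * (Real.exp (c * (L / 2)) - Real.exp (-(c * (L / 2)))))) /
        (c ^ 2 + (2 * π * n / L) ^ 2) := by
  have hb : ∀ x, Real.sin (2 * π * n * x / L) = Real.sin (2 * π * n / L * x) := fun x => by
    congr 1; ring
  simp_rw [hb]
  rw [integral_exp_mul_sin c (2 * π * n / L) _ _ h]
  have e1 : 2 * π * n / L * (L / 2) = n * π := by field_simp
  have e2 : 2 * π * n / L * (-(L / 2)) = -(n * π) := by rw [mul_neg, e1]
  rw [e1, e2, Real.cos_neg, Real.sin_neg, Real.cos_int_mul_pi, Real.sin_int_mul_pi,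
    show c * (-(L / 2)) = -(c * (L / 2)) by ring]
  ring

/-- PROVED: `∫_{−L/2}^{L/2} e^{cx} dx = (e^{cL/2} − e^{−cL/2})/c` for `c ≠ 0`. [folklore] -/
private theorem integral_exp_window (L : ℝ) {c : ℝ} (hc : c ≠ 0) :
    ∫ x in (-(L / 2))..(L / 2), Real.exp (c * x) =
      (Real.exp (c * (L / 2)) - Real.exp (-(c * (L / 2)))) / c := by
  have hd : ∀ x, HasDerivAt (fun y => Real.exp (c * y) / c) (Real.exp (c * x)) x := by
    intro x
    have h1 : HasDerivAt (fun y : ℝ => c * y) c x := by simpa using (hasDerivAt_id x).const_mul c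
    refine (h1.exp.div_const c).congr_deriv ?_
    field_simp
  rw [integral_eq_sub_of_hasDerivAt (fun x _ => hd x) (by apply Continuous.intervalIntegrable; fun_prop),
    show c * (-(L / 2)) = -(c * (L / 2)) by ring]
  ring

/-! ## §3 The weight `e^{ct}` distributes over the convolution (mechanism of Prop. 2.1) -/

/-- PROVED: for every `t`, `(φ ⋆ g)(t) · e^{ct} = ((φ · e^{c·}) ⋆ (g · e^{c·}))(t)` — because
`e^{ct} = e^{cx} e^{c(t−x)}`; no integrability needed. [folklore] -/
private theorem convolution_mul_exp (φ g : ℝ → ℝ) (c t : ℝ) :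
    (φ ⋆ g) t * Real.exp (c * t) =
      ((fun x => φ x * Real.exp (c * x)) ⋆ (fun x => g x * Real.exp (c * x))) t := by
  rw [convolution_lsmul, convolution_lsmul, ← MeasureTheory.integral_mul_const]
  congr 1
  funext x
  simp only [smul_eq_mul]
  rw [show c * t = c * x + c * (t - x) by ring, Real.exp_add]
  ring

/-- PROVED (the Fubini step, "route A"): `P_c(φ ⋆ g) = P_c(φ) · P_c(g)` whenever `φ e^{c·}` and `g e^{c·}` are
integrable. [cite: ConnesConsani2023, proof of Prop. 2.1 (polar term as `⟨f|Tf⟩`, `T = |h⟩⟨h^*| + |h^*⟩⟨h|`), p. 103] -/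
theorem polar_convolution {φ g : ℝ → ℝ} (c : ℝ)
    (hφ : Integrable (fun x => φ x * Real.exp (c * x)))
    (hg : Integrable (fun x => g x * Real.exp (c * x))) :
    polar c (φ ⋆ g) = polar c φ * polar c g := by
  unfold polar
  simp_rw [convolution_mul_exp φ g c]
  rw [integral_convolution (ContinuousLinearMap.lsmul ℝ ℝ) hφ hg]
  simp

/-- PROVED: `P_c(ψ^*) = P_{−c}(ψ)` (so `F̂(−i/2)` brings in `h^*`). [cite: ConnesConsani2023, proof of Prop. 2.1
(`T = |h⟩⟨h^*| + |h^*⟩⟨h|`), p. 103] -/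
theorem polar_adj (c : ℝ) (ψ : ℝ → ℝ) : polar c (adj ψ) = polar (-c) ψ := by
  unfold polar adj
  have h := integral_neg_eq_self (fun t => ψ t * Real.exp (-c * t)) volume
  simp only [mul_neg, neg_mul, neg_neg] at h
  rw [h]
  congr 1
  funext t
  rw [neg_mul]

/-- PROVED: `e^{ct} · ((φ ⋆ g)(t))` is integrable when `φ e^{c·}` and `g e^{c·}` are. [folklore] -/
private theorem integrable_convolution_mul_exp {φ g : ℝ → ℝ} (c : ℝ)
    (hφ : Integrable (fun x => φ x * Real.exp (c * x)))
    (hg : Integrable (fun x => g x * Real.exp (c * x))) :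
    Integrable (fun t => (φ ⋆ g) t * Real.exp (c * t)) := by
  have : (fun t => (φ ⋆ g) t * Real.exp (c * t)) =
      ((fun x => φ x * Real.exp (c * x)) ⋆ (fun x => g x * Real.exp (c * x))) := by
    funext t; exact convolution_mul_exp φ g c t
  rw [this]
  exact hφ.integrable_convolution (ContinuousLinearMap.lsmul ℝ ℝ) hg

/-- PROVED: `∫_ℝ θ(t)(e^{t/2} + e^{-t/2}) dt = P_{1/2}(θ) + P_{−1/2}(θ)` (splitting the integral). [folklore] -/
private theorem polarSum_eq_add (θ : ℝ → ℝ)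
    (h1 : Integrable (fun t => θ t * Real.exp ((1 / 2 : ℝ) * t)))
    (h2 : Integrable (fun t => θ t * Real.exp (-(1 / 2 : ℝ) * t))) :
    polarSum θ = polar (1 / 2) θ + polar (-(1 / 2)) θ := by
  unfold polarSum polar
  rw [← integral_add h1 h2]
  congr 1
  funext t
  rw [show (1 / 2 : ℝ) * t = t / 2 by ring, show -(1 / 2 : ℝ) * t = -(t / 2) by ring]
  ring

/-- PROVED (the substitution `x = e^t`, `d^*x = dt`): `∫_{ℝ₊^*} θ(log x)(x^{1/2} + x^{-1/2}) d^*x =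
∫_ℝ θ(t)(e^{t/2} + e^{-t/2}) dt`, unconditionally (both sides are Bochner integrals).
[cite: ConnesConsani2023, proof of Lemma 2.7, first display, p. 110] -/
theorem hatPolarSum_comp_log (θ : ℝ → ℝ) :
    hatPolarSum (fun x => θ (Real.log x)) = polarSum θ := by
  unfold hatPolarSum polarSum
  have himg : Real.exp '' (univ : Set ℝ) = Ioi 0 := by rw [image_univ, Real.range_exp]
  rw [← himg, integral_image_eq_integral_abs_deriv_smul MeasurableSet.univ
    (fun x _ => (Real.hasDerivAt_exp x).hasDerivWithinAt) Real.exp_injective.injOn,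
    Measure.restrict_univ]
  congr 1
  funext t
  have het : 0 < Real.exp t := Real.exp_pos t
  have hne : Real.exp t ≠ 0 := het.ne'
  have e1 : Real.exp t ^ (1 / 2 : ℝ) = Real.exp (t / 2) := by
    rw [← Real.exp_mul]; congr 1; ring
  have e2 : Real.exp t ^ (-(1 / 2) : ℝ) = Real.exp (-(t / 2)) := by
    rw [← Real.exp_mul]; congr 1; ring
  simp only [Real.log_exp, smul_eq_mul, abs_of_pos het, e1, e2]
  field_simp

/-! ## §4 The moments `a_n^{(c)} = ∫ ξ_n e^{cx}` in closed form -/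

/-- PROVED: the untruncated basis formula is continuous. [folklore] -/
private theorem continuous_xiCore (L : ℝ) (n : ℤ) : Continuous (xiCore L n) := by
  unfold xiCore
  split_ifs <;> fun_prop

/-- PROVED: `ξ_n · w` is the truncation of `ξ_n^{core} · w`. [folklore] -/
private theorem xi_mul (L : ℝ) (n : ℤ) (w : ℝ → ℝ) (x : ℝ) :
    xi L n x * w x = (Icc (-(L / 2)) (L / 2)).indicator (fun y => xiCore L n y * w y) x := by
  unfold xi
  exact (Set.indicator_mul_left _ _ _).symm

/-- PROVED: `ξ_n e^{c·}` is integrable on `ℝ` (bounded, compact support). [folklore] -/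
private theorem integrable_xi_mul_exp (L c : ℝ) (n : ℤ) :
    Integrable (fun x => xi L n x * Real.exp (c * x)) := by
  have : (fun x => xi L n x * Real.exp (c * x)) =
      (Icc (-(L / 2)) (L / 2)).indicator (fun y => xiCore L n y * Real.exp (c * y)) := by
    funext x; exact xi_mul L n (fun y => Real.exp (c * y)) x
  rw [this, integrable_indicator_iff measurableSet_Icc]
  exact ((continuous_xiCore L n).mul (by fun_prop)).continuousOn.integrableOn_compact isCompact_Icc

/-- PROVED: `ξ_n^* e^{c·}` is integrable on `ℝ`. [folklore] -/
private theorem integrable_adj_xi_mul_exp (L c : ℝ) (n : ℤ) :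
    Integrable (fun x => adj (xi L n) x * Real.exp (c * x)) := by
  have h := (integrable_xi_mul_exp L (-c) n).comp_neg
  refine h.congr (Filter.Eventually.of_forall fun x => ?_)
  simp [adj, neg_mul, mul_neg]

/-- PROVED: `a_n^{(c)} = ∫_{−L/2}^{L/2} ξ_n^{core}(x) e^{cx} dx` (`0 ≤ L`). [folklore] -/
private theorem moment_eq_intervalIntegral {L : ℝ} (hL : 0 ≤ L) (c : ℝ) (n : ℤ) :
    moment L c n = ∫ x in (-(L / 2))..(L / 2), xiCore L n x * Real.exp (c * x) := by
  unfold moment polar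
  have : (fun x => xi L n x * Real.exp (c * x)) =
      (Icc (-(L / 2)) (L / 2)).indicator (fun y => xiCore L n y * Real.exp (c * y)) := by
    funext x; exact xi_mul L n (fun y => Real.exp (c * y)) x
  rw [this, MeasureTheory.integral_indicator measurableSet_Icc, integral_Icc_eq_integral_Ioc,
    intervalIntegral.integral_of_le (by linarith)]

/-- PROVED: `(−1)^n (−1)^n = 1` for `n ∈ ℤ`. [folklore] -/
private theorem neg_one_zpow_mul_self (n : ℤ) : (-1 : ℝ) ^ n * (-1 : ℝ) ^ n = 1 := by
  rw [← zpow_add₀ (by norm_num : (-1 : ℝ) ≠ 0), ← two_mul, zpow_mul]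
  norm_num

/-- PROVED (cosine modes, `n > 0`): `a_n^{(c)} = (2/L)^{1/2} · c (e^{cL/2} − e^{−cL/2}) / (c² + (2πn/L)²)` — the sign
`(−1)^n` of the basis cancels against `cos(±nπ) = (−1)^n`. [folklore] -/
private theorem moment_pos {L : ℝ} (hL : 0 < L) {n : ℤ} (hn : 0 < n) (c : ℝ) :
    moment L c n = Real.sqrt (2 / L) * (c * (Real.exp (c * (L / 2)) - Real.exp (-(c * (L / 2))))) /
      (c ^ 2 + (2 * π * n / L) ^ 2) := by
  have hn' : (0 : ℝ) < n := Int.cast_pos.mpr hn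
  have hD : c ^ 2 + (2 * π * n / L) ^ 2 ≠ 0 := by positivity
  rw [moment_eq_intervalIntegral hL.le]
  have hcore : ∀ x, xiCore L n x * Real.exp (c * x) =
      ((-1 : ℝ) ^ n * Real.sqrt (2 / L)) * (Real.exp (c * x) * Real.cos (2 * π * n * x / L)) := fun x => by
    simp only [xiCore, hn.ne', hn, if_false, if_true]; ring
  simp_rw [hcore]
  rw [intervalIntegral.integral_const_mul, integral_exp_mul_cos_window hL.ne' n c hD]
  have hs := neg_one_zpow_mul_self n
  calc (-1 : ℝ) ^ n * Real.sqrt (2 / L) *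
        ((-1 : ℝ) ^ n * (c * (Real.exp (c * (L / 2)) - Real.exp (-(c * (L / 2))))) /
          (c ^ 2 + (2 * π * n / L) ^ 2))
      = ((-1 : ℝ) ^ n * (-1 : ℝ) ^ n) * (Real.sqrt (2 / L) *
          (c * (Real.exp (c * (L / 2)) - Real.exp (-(c * (L / 2))))) /
          (c ^ 2 + (2 * π * n / L) ^ 2)) := by ring
    _ = _ := by rw [hs, one_mul]

/-- PROVED (sine modes, `n < 0`): `a_n^{(c)} = −(2/L)^{1/2} · (2πn/L)(e^{cL/2} − e^{−cL/2}) / (c² + (2πn/L)²)`. [folklore] -/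
private theorem moment_neg {L : ℝ} (hL : 0 < L) {n : ℤ} (hn : n < 0) (c : ℝ) :
    moment L c n = -(Real.sqrt (2 / L) * ((2 * π * n / L) *
      (Real.exp (c * (L / 2)) - Real.exp (-(c * (L / 2)))))) / (c ^ 2 + (2 * π * n / L) ^ 2) := by
  have hn' : (n : ℝ) < 0 := Int.cast_lt_zero.mpr hn
  have hb : 2 * π * n / L ≠ 0 := by
    have : 2 * π * n / L < 0 := by
      apply div_neg_of_neg_of_pos _ hL
      nlinarith [Real.pi_pos]
    exact this.ne
  have hD : c ^ 2 + (2 * π * n / L) ^ 2 ≠ 0 := by positivity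
  rw [moment_eq_intervalIntegral hL.le]
  have hcore : ∀ x, xiCore L n x * Real.exp (c * x) =
      ((-1 : ℝ) ^ n * Real.sqrt (2 / L)) * (Real.exp (c * x) * Real.sin (2 * π * n * x / L)) := fun x => by
    simp only [xiCore, hn.ne, not_lt.mpr hn.le, if_false]; ring
  simp_rw [hcore]
  rw [intervalIntegral.integral_const_mul, integral_exp_mul_sin_window hL.ne' n c hD]
  have hs := neg_one_zpow_mul_self n
  calc (-1 : ℝ) ^ n * Real.sqrt (2 / L) *
        (-((-1 : ℝ) ^ n * (2 * π * n / L * (Real.exp (c * (L / 2)) - Real.exp (-(c * (L / 2)))))) /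
          (c ^ 2 + (2 * π * n / L) ^ 2))
      = -(((-1 : ℝ) ^ n * (-1 : ℝ) ^ n) * (Real.sqrt (2 / L) * (2 * π * n / L *
          (Real.exp (c * (L / 2)) - Real.exp (-(c * (L / 2))))))) / (c ^ 2 + (2 * π * n / L) ^ 2) := by
        ring
    _ = _ := by rw [hs, one_mul]

/-- PROVED (constant mode): `a_0^{(c)} = L^{-1/2} (e^{cL/2} − e^{−cL/2})/c` for `c ≠ 0`. [folklore] -/
private theorem moment_zero {L : ℝ} (hL : 0 < L) {c : ℝ} (hc : c ≠ 0) :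
    moment L c 0 = 1 / Real.sqrt L * ((Real.exp (c * (L / 2)) - Real.exp (-(c * (L / 2)))) / c) := by
  rw [moment_eq_intervalIntegral hL.le]
  have hcore : ∀ x, xiCore L 0 x * Real.exp (c * x) = (1 / Real.sqrt L) * Real.exp (c * x) := fun x => by
    simp [xiCore]
  simp_rw [hcore]
  rw [intervalIntegral.integral_const_mul, integral_exp_window L hc]

/-! ## §5 The moments at `c = ± 1/2` -/

/-- PROVED: `a_n^{(1/2)} = 2 (2/L)^{1/2} L² (e^{L/4} − e^{−L/4}) / (L² + 16π²n²)` for `n > 0`.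
[cite: ConnesConsani2023, proof of Prop. 2.1 (`f̂(i/2) = ⟨h|f⟩`, `h(u) = u^{1/2}`), p. 103 — these are the coordinates `⟨h|η_n⟩`; the closed form is computed here, it is not displayed in print] -/
theorem moment_pos_half {L : ℝ} (hL : 0 < L) {n : ℤ} (hn : 0 < n) :
    moment L (1 / 2) n = 2 * Real.sqrt (2 / L) * L ^ 2 * (Real.exp (L / 4) - Real.exp (-(L / 4))) /
      (L ^ 2 + 16 * π ^ 2 * n ^ 2) := by
  have hD : L ^ 2 + 16 * π ^ 2 * n ^ 2 ≠ 0 := by positivity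
  rw [moment_pos hL hn, show (1 / 2 : ℝ) * (L / 2) = L / 4 by ring]
  field_simp
  ring

/-- PROVED: `a_n^{(−1/2)} = a_n^{(1/2)}` for `n > 0` (cosine modes are even).
[cite: ConnesConsani2023, proof of Prop. 2.1 (`f̂(i/2) = ⟨h|f⟩`, `h(u) = u^{1/2}`), p. 103 — these are the coordinates `⟨h|η_n⟩`; the closed form is computed here, it is not displayed in print] -/
theorem moment_pos_neg_half {L : ℝ} (hL : 0 < L) {n : ℤ} (hn : 0 < n) :
    moment L (-(1 / 2)) n = 2 * Real.sqrt (2 / L) * L ^ 2 * (Real.exp (L / 4) - Real.exp (-(L / 4))) /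
      (L ^ 2 + 16 * π ^ 2 * n ^ 2) := by
  have hD : L ^ 2 + 16 * π ^ 2 * n ^ 2 ≠ 0 := by positivity
  rw [moment_pos hL hn, show -(1 / 2 : ℝ) * (L / 2) = -(L / 4) by ring, neg_neg]
  field_simp
  ring

/-- PROVED: `a_n^{(1/2)} = −8π n L (2/L)^{1/2} (e^{L/4} − e^{−L/4}) / (L² + 16π²n²)` for `n < 0` (a positive number).
[cite: ConnesConsani2023, proof of Prop. 2.1 (`f̂(i/2) = ⟨h|f⟩`, `h(u) = u^{1/2}`), p. 103 — these are the coordinates `⟨h|η_n⟩`; the closed form is computed here, it is not displayed in print] -/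
theorem moment_neg_half {L : ℝ} (hL : 0 < L) {n : ℤ} (hn : n < 0) :
    moment L (1 / 2) n = -(8 * π * n * L * Real.sqrt (2 / L) * (Real.exp (L / 4) - Real.exp (-(L / 4)))) /
      (L ^ 2 + 16 * π ^ 2 * n ^ 2) := by
  have hn' : (n : ℝ) ≠ 0 := by exact_mod_cast hn.ne
  have hD : L ^ 2 + 16 * π ^ 2 * n ^ 2 ≠ 0 := by positivity
  rw [moment_neg hL hn, show (1 / 2 : ℝ) * (L / 2) = L / 4 by ring]
  field_simp
  ring

/-- PROVED: `a_n^{(−1/2)} = −a_n^{(1/2)}` for `n < 0` (sine modes are odd).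
[cite: ConnesConsani2023, proof of Prop. 2.1 (`f̂(i/2) = ⟨h|f⟩`, `h(u) = u^{1/2}`), p. 103 — these are the coordinates `⟨h|η_n⟩`; the closed form is computed here, it is not displayed in print] -/
theorem moment_neg_neg_half {L : ℝ} (hL : 0 < L) {n : ℤ} (hn : n < 0) :
    moment L (-(1 / 2)) n = (8 * π * n * L * Real.sqrt (2 / L) * (Real.exp (L / 4) - Real.exp (-(L / 4)))) /
      (L ^ 2 + 16 * π ^ 2 * n ^ 2) := by
  have hn' : (n : ℝ) ≠ 0 := by exact_mod_cast hn.ne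
  have hD : L ^ 2 + 16 * π ^ 2 * n ^ 2 ≠ 0 := by positivity
  rw [moment_neg hL hn, show -(1 / 2 : ℝ) * (L / 2) = -(L / 4) by ring, neg_neg]
  field_simp
  ring

/-- PROVED: `a_0^{(1/2)} = 2 (e^{L/4} − e^{−L/4}) / L^{1/2}`.
[cite: ConnesConsani2023, proof of Prop. 2.1 (`f̂(i/2) = ⟨h|f⟩`, `h(u) = u^{1/2}`), p. 103 — these are the coordinates `⟨h|η_n⟩`; the closed form is computed here, it is not displayed in print] -/
theorem moment_zero_half {L : ℝ} (hL : 0 < L) :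
    moment L (1 / 2) 0 = 2 * (Real.exp (L / 4) - Real.exp (-(L / 4))) / Real.sqrt L := by
  rw [moment_zero hL (by norm_num : (1 / 2 : ℝ) ≠ 0), show (1 / 2 : ℝ) * (L / 2) = L / 4 by ring]
  have : Real.sqrt L ≠ 0 := by positivity
  field_simp

/-- PROVED: `a_0^{(−1/2)} = a_0^{(1/2)}`.
[cite: ConnesConsani2023, proof of Prop. 2.1 (`f̂(i/2) = ⟨h|f⟩`, `h(u) = u^{1/2}`), p. 103 — these are the coordinates `⟨h|η_n⟩`; the closed form is computed here, it is not displayed in print] -/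
theorem moment_zero_neg_half {L : ℝ} (hL : 0 < L) :
    moment L (-(1 / 2)) 0 = 2 * (Real.exp (L / 4) - Real.exp (-(L / 4))) / Real.sqrt L := by
  rw [moment_zero hL (by norm_num : (-(1 / 2) : ℝ) ≠ 0), show -(1 / 2 : ℝ) * (L / 2) = -(L / 4) by ring,
    neg_neg]
  have : Real.sqrt L ≠ 0 := by positivity
  field_simp
  ring

/-! ## §6 Lemma 2.7 — the polar term on the basis, even case CORRECTED, odd case as printed -/

/-- PROVED (route A): for `θ = ξ_m * ξ_n^*`,
`∫ θ(t)(e^{t/2} + e^{−t/2}) dt = a_m^{(1/2)} a_n^{(−1/2)} + a_m^{(−1/2)} a_n^{(1/2)}` — the polar term is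
`⟨f|Tg⟩`, `T = |h⟩⟨h^*| + |h^*⟩⟨h|`. [cite: ConnesConsani2023, proof of Prop. 2.1, p. 103] -/
theorem polarSum_xi_conv (L : ℝ) (m n : ℤ) :
    polarSum (xi L m ⋆ adj (xi L n)) =
      moment L (1 / 2) m * moment L (-(1 / 2)) n + moment L (-(1 / 2)) m * moment L (1 / 2) n := by
  have i1 := fun c => integrable_convolution_mul_exp c (integrable_xi_mul_exp L c m)
    (integrable_adj_xi_mul_exp L c n)
  rw [polarSum_eq_add _ (i1 _) (i1 _),
    polar_convolution _ (integrable_xi_mul_exp L _ m) (integrable_adj_xi_mul_exp L _ n),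
    polar_convolution _ (integrable_xi_mul_exp L _ m) (integrable_adj_xi_mul_exp L _ n),
    polar_adj, polar_adj, neg_neg]
  simp only [moment]

/-- PROVED: `e^{L/2} = e^{L/4} e^{L/4}`. [folklore] -/
private theorem exp_half_eq_mul_quarter (L : ℝ) : Real.exp (L / 2) = Real.exp (L / 4) * Real.exp (L / 4) := by
  rw [← Real.exp_add]; congr 1; ring

/-- **PROVED — Connes–Consani 2021/2023 Lemma 2.7, EVEN case, with the CORRECTED constant `16`** (printed: `8`):
for `L > 0`, integers `n, m > 0`, `θ = ξ_m * ξ_n^*` and `F = θ ∘ log`,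
`F̂(i/2) + F̂(−i/2) = ∫_ℝ θ(t)(e^{t/2} + e^{−t/2}) dt = 16 e^{−L/2}(e^{L/2} − 1)² L³ / ((L² + 16π²m²)(L² + 16π²n²))`
(use `hatPolarSum_comp_log` for the first equality).
[cite: ConnesConsani2023, Lemma 2.7 eq. (2.29), p. 109 — ERRATUM: printed constant 8, correct constant 16] -/
theorem lemma27_even {L : ℝ} (hL : 0 < L) {n m : ℤ} (hn : 0 < n) (hm : 0 < m) :
    polarSum (xi L m ⋆ adj (xi L n)) =
      16 * Real.exp (-(L / 2)) * (Real.exp (L / 2) - 1) ^ 2 * L ^ 3 /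
        ((L ^ 2 + 16 * π ^ 2 * m ^ 2) * (L ^ 2 + 16 * π ^ 2 * n ^ 2)) := by
  have hDm : L ^ 2 + 16 * π ^ 2 * m ^ 2 ≠ 0 := by positivity
  have hDn : L ^ 2 + 16 * π ^ 2 * n ^ 2 ≠ 0 := by positivity
  have hE : Real.exp (L / 4) ≠ 0 := (Real.exp_pos _).ne'
  rw [polarSum_xi_conv, moment_pos_half hL hm, moment_pos_neg_half hL hn, moment_pos_neg_half hL hm,
    moment_pos_half hL hn]
  set Δ := Real.exp (L / 4) - Real.exp (-(L / 4)) with hΔ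
  have key : 2 * Real.sqrt (2 / L) * L ^ 2 * Δ / (L ^ 2 + 16 * π ^ 2 * m ^ 2) *
        (2 * Real.sqrt (2 / L) * L ^ 2 * Δ / (L ^ 2 + 16 * π ^ 2 * n ^ 2)) +
      2 * Real.sqrt (2 / L) * L ^ 2 * Δ / (L ^ 2 + 16 * π ^ 2 * m ^ 2) *
        (2 * Real.sqrt (2 / L) * L ^ 2 * Δ / (L ^ 2 + 16 * π ^ 2 * n ^ 2)) =
      (Real.sqrt (2 / L) * Real.sqrt (2 / L)) *
        (8 * L ^ 4 * Δ ^ 2 / (L ^ 2 + 16 * π ^ 2 * m ^ 2) / (L ^ 2 + 16 * π ^ 2 * n ^ 2)) := by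
    ring
  rw [key, Real.mul_self_sqrt (by positivity), hΔ, Real.exp_neg, Real.exp_neg, exp_half_eq_mul_quarter]
  field_simp
  ring

/-- PROVED — the ERRATUM in one line: the even polar term is exactly TWICE the printed right-hand side of
(2.29)/(h02). [cite: ConnesConsani2023, Lemma 2.7 eq. (2.29), p. 109] -/
theorem lemma27_even_eq_two_mul_printed {L : ℝ} (hL : 0 < L) {n m : ℤ} (hn : 0 < n) (hm : 0 < m) :
    polarSum (xi L m ⋆ adj (xi L n)) =
      2 * (8 * Real.exp (-(L / 2)) * (Real.exp (L / 2) - 1) ^ 2 * L ^ 3 /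
        ((L ^ 2 + 16 * π ^ 2 * m ^ 2) * (L ^ 2 + 16 * π ^ 2 * n ^ 2))) := by
  rw [lemma27_even hL hn hm]
  ring

/-- **PROVED — Connes–Consani 2021/2023 Lemma 2.7, ODD case, as printed**: for `n, m < 0`, `θ = ξ_m * ξ_n^*`,
`∫_ℝ θ(t)(e^{t/2} + e^{−t/2}) dt = −256 π² L e^{−L/2}(e^{L/2} − 1)² m n / ((L² + 16π²m²)(L² + 16π²n²))`.
[cite: ConnesConsani2023, Lemma 2.7 eq. (2.30), p. 110] -/
theorem lemma27_odd {L : ℝ} (hL : 0 < L) {n m : ℤ} (hn : n < 0) (hm : m < 0) :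
    polarSum (xi L m ⋆ adj (xi L n)) =
      -(256 * π ^ 2 * L * Real.exp (-(L / 2)) * (Real.exp (L / 2) - 1) ^ 2 * m * n) /
        ((L ^ 2 + 16 * π ^ 2 * m ^ 2) * (L ^ 2 + 16 * π ^ 2 * n ^ 2)) := by
  have hDm : L ^ 2 + 16 * π ^ 2 * m ^ 2 ≠ 0 := by positivity
  have hDn : L ^ 2 + 16 * π ^ 2 * n ^ 2 ≠ 0 := by positivity
  have hE : Real.exp (L / 4) ≠ 0 := (Real.exp_pos _).ne'
  rw [polarSum_xi_conv, moment_neg_half hL hm, moment_neg_neg_half hL hn, moment_neg_neg_half hL hm,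
    moment_neg_half hL hn]
  set Δ := Real.exp (L / 4) - Real.exp (-(L / 4)) with hΔ
  have key : -(8 * π * m * L * Real.sqrt (2 / L) * Δ) / (L ^ 2 + 16 * π ^ 2 * m ^ 2) *
        (8 * π * n * L * Real.sqrt (2 / L) * Δ / (L ^ 2 + 16 * π ^ 2 * n ^ 2)) +
      8 * π * m * L * Real.sqrt (2 / L) * Δ / (L ^ 2 + 16 * π ^ 2 * m ^ 2) *
        (-(8 * π * n * L * Real.sqrt (2 / L) * Δ) / (L ^ 2 + 16 * π ^ 2 * n ^ 2)) =
      (Real.sqrt (2 / L) * Real.sqrt (2 / L)) *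
        (-(128 * π ^ 2 * m * n * L ^ 2 * Δ ^ 2) /
          (L ^ 2 + 16 * π ^ 2 * m ^ 2) / (L ^ 2 + 16 * π ^ 2 * n ^ 2)) := by
    ring
  rw [key, Real.mul_self_sqrt (by positivity), hΔ, Real.exp_neg, Real.exp_neg, exp_half_eq_mul_quarter]
  field_simp
  ring

/-- PROVED — Lemma 2.7, even case (corrected), in the paper's MULTIPLICATIVE form: with `F = θ ∘ log`,
`θ = ξ_m * ξ_n^*`, `n, m > 0`: `∫_{ℝ₊^*} F(x)(x^{1/2} + x^{−1/2}) d^*x = 16 e^{−L/2}(e^{L/2} − 1)² L³/((L²+16π²m²)(L²+16π²n²))`.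
[cite: ConnesConsani2023, Lemma 2.7 eq. (2.29), p. 109 — ERRATUM: printed constant 8, correct constant 16] -/
theorem lemma27_even_hat {L : ℝ} (hL : 0 < L) {n m : ℤ} (hn : 0 < n) (hm : 0 < m) :
    hatPolarSum (fun x => (xi L m ⋆ adj (xi L n)) (Real.log x)) =
      16 * Real.exp (-(L / 2)) * (Real.exp (L / 2) - 1) ^ 2 * L ^ 3 /
        ((L ^ 2 + 16 * π ^ 2 * m ^ 2) * (L ^ 2 + 16 * π ^ 2 * n ^ 2)) := by
  rw [hatPolarSum_comp_log]
  exact lemma27_even hL hn hm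

/-- PROVED — Lemma 2.7, odd case (as printed), in the paper's MULTIPLICATIVE form (`n, m < 0`).
[cite: ConnesConsani2023, Lemma 2.7 eq. (2.30), p. 110] -/
theorem lemma27_odd_hat {L : ℝ} (hL : 0 < L) {n m : ℤ} (hn : n < 0) (hm : m < 0) :
    hatPolarSum (fun x => (xi L m ⋆ adj (xi L n)) (Real.log x)) =
      -(256 * π ^ 2 * L * Real.exp (-(L / 2)) * (Real.exp (L / 2) - 1) ^ 2 * m * n) /
        ((L ^ 2 + 16 * π ^ 2 * m ^ 2) * (L ^ 2 + 16 * π ^ 2 * n ^ 2)) := by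
  rw [hatPolarSum_comp_log]
  exact lemma27_odd hL hn hm

/-! ## §7 The rank-one normal forms of the polar blocks (agreement with the tree's table-based block) -/

/-- The generating vector of the EVEN polar block: `g_0 = 2√2`, `g_n = 1/(1/4 + (2πn/L)²)` (`n ≥ 1`) — the same
expression as `Summit.RiemannHypothesis.RiemannHypothesis.Theorems.PfPersistence.polarGen` (with `Dk k = 1/4 + k²`).
[cite: ConnesConsani2023, §2.1.4, p. 109] -/
def genEven (L : ℝ) (n : ℕ) : ℝ := if n = 0 then 2 * Real.sqrt 2 else 1 / (1 / 4 + (2 * π * n / L) ^ 2)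

/-- PROVED — EVEN POLAR BLOCK IN RANK-ONE FORM: for all `n, m ≥ 0` (the constant mode `ξ_0` included),
`∫ (ξ_m * ξ_n^*)(t)(e^{t/2} + e^{−t/2}) dt = ρ(L) g_n g_m` with `ρ(L) = 2(cosh(L/2) − 1)/L` — literally the right-hand
side of the tree's `PfPersistence.PolarRankOne.W02_thetaEven` (which computes the same block from the TABLE of
Lemma 2.6 (iii)); hence `w_{0,2}^+ = 2 c_e c_eᵀ` with `(c_e)_n = (ρ/2)^{1/2} g_n = a_n^{(1/2)}`. [cite: ConnesConsani2023, §2.1.4, first sentence ("these terms contribute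
by a rank one matrix to both the odd and the even matrices `σ^±`"), p. 109] -/
theorem polarSum_even_rankOne {L : ℝ} (hL : 0 < L) (n m : ℕ) :
    polarSum (xi L m ⋆ adj (xi L n)) =
      2 * (Real.cosh (L / 2) - 1) / L * genEven L n * genEven L m := by
  have hL0 : L ≠ 0 := hL.ne'
  have hE : Real.exp (L / 4) ≠ 0 := (Real.exp_pos _).ne'
  have hsL : Real.sqrt L ≠ 0 := by positivity
  have hs2 : Real.sqrt 2 * Real.sqrt 2 = 2 := Real.mul_self_sqrt (by norm_num)
  have hsLL : Real.sqrt L * Real.sqrt L = L := Real.mul_self_sqrt hL.le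
  have hs2L : Real.sqrt (2 / L) = Real.sqrt 2 / Real.sqrt L := Real.sqrt_div' 2 hL.le
  have hcosh : Real.cosh (L / 2) = (Real.exp (L / 4) * Real.exp (L / 4) + (Real.exp (L / 4) * Real.exp (L / 4))⁻¹) / 2 := by
    rw [Real.cosh_eq, Real.exp_neg, exp_half_eq_mul_quarter]
  rw [polarSum_xi_conv]
  rcases Nat.eq_zero_or_pos n with hn | hn <;> rcases Nat.eq_zero_or_pos m with hm | hm
  · subst hn; subst hm
    simp only [genEven, if_true, Nat.cast_zero]
    rw [moment_zero_half hL, moment_zero_neg_half hL]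
    set Δ := Real.exp (L / 4) - Real.exp (-(L / 4)) with hΔ
    have key : 2 * Δ / Real.sqrt L * (2 * Δ / Real.sqrt L) + 2 * Δ / Real.sqrt L * (2 * Δ / Real.sqrt L) =
        8 * Δ ^ 2 / (Real.sqrt L * Real.sqrt L) := by ring
    have key2 : 2 * (Real.cosh (L / 2) - 1) / L * (2 * Real.sqrt 2) * (2 * Real.sqrt 2) =
        8 * (Real.sqrt 2 * Real.sqrt 2) * (Real.cosh (L / 2) - 1) / L := by ring
    rw [key, key2, hsLL, hs2, hcosh, hΔ, Real.exp_neg]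
    field_simp
    ring
  · subst hn
    have hm' : (0 : ℤ) < (m : ℤ) := by exact_mod_cast hm
    have hmR : (0 : ℝ) < m := by exact_mod_cast hm
    simp only [genEven, if_true, Nat.cast_zero, hm.ne', if_false]
    rw [moment_zero_half hL, moment_zero_neg_half hL, moment_pos_half hL hm', moment_pos_neg_half hL hm', hs2L]
    push_cast
    set Δ := Real.exp (L / 4) - Real.exp (-(L / 4)) with hΔ
    have hD : L ^ 2 + 16 * π ^ 2 * (m : ℝ) ^ 2 ≠ 0 := by positivity
    have hD' : 1 / 4 + (2 * π * (m : ℝ) / L) ^ 2 ≠ 0 := by positivity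
    have key : 2 * (Real.sqrt 2 / Real.sqrt L) * L ^ 2 * Δ / (L ^ 2 + 16 * π ^ 2 * (m : ℝ) ^ 2) *
          (2 * Δ / Real.sqrt L) +
        2 * (Real.sqrt 2 / Real.sqrt L) * L ^ 2 * Δ / (L ^ 2 + 16 * π ^ 2 * (m : ℝ) ^ 2) *
          (2 * Δ / Real.sqrt L) =
        8 * Real.sqrt 2 * L ^ 2 * Δ ^ 2 / (L ^ 2 + 16 * π ^ 2 * (m : ℝ) ^ 2) / (Real.sqrt L * Real.sqrt L) := by
      ring
    rw [key, hsLL, hcosh, hΔ, Real.exp_neg]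
    field_simp
    ring
  · subst hm
    have hn' : (0 : ℤ) < (n : ℤ) := by exact_mod_cast hn
    have hnR : (0 : ℝ) < n := by exact_mod_cast hn
    simp only [genEven, if_true, Nat.cast_zero, hn.ne', if_false]
    rw [moment_zero_half hL, moment_zero_neg_half hL, moment_pos_half hL hn', moment_pos_neg_half hL hn', hs2L]
    push_cast
    set Δ := Real.exp (L / 4) - Real.exp (-(L / 4)) with hΔ
    have hD : L ^ 2 + 16 * π ^ 2 * (n : ℝ) ^ 2 ≠ 0 := by positivity
    have hD' : 1 / 4 + (2 * π * (n : ℝ) / L) ^ 2 ≠ 0 := by positivity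
    have key : 2 * Δ / Real.sqrt L *
          (2 * (Real.sqrt 2 / Real.sqrt L) * L ^ 2 * Δ / (L ^ 2 + 16 * π ^ 2 * (n : ℝ) ^ 2)) +
        2 * Δ / Real.sqrt L *
          (2 * (Real.sqrt 2 / Real.sqrt L) * L ^ 2 * Δ / (L ^ 2 + 16 * π ^ 2 * (n : ℝ) ^ 2)) =
        8 * Real.sqrt 2 * L ^ 2 * Δ ^ 2 / (L ^ 2 + 16 * π ^ 2 * (n : ℝ) ^ 2) / (Real.sqrt L * Real.sqrt L) := by
      ring
    rw [key, hsLL, hcosh, hΔ, Real.exp_neg]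
    field_simp
    ring
  · have hn' : (0 : ℤ) < (n : ℤ) := by exact_mod_cast hn
    have hm' : (0 : ℤ) < (m : ℤ) := by exact_mod_cast hm
    have hnR : (0 : ℝ) < n := by exact_mod_cast hn
    have hmR : (0 : ℝ) < m := by exact_mod_cast hm
    simp only [genEven, hn.ne', hm.ne', if_false]
    rw [moment_pos_half hL hm', moment_pos_neg_half hL hn', moment_pos_neg_half hL hm', moment_pos_half hL hn']
    push_cast
    set Δ := Real.exp (L / 4) - Real.exp (-(L / 4)) with hΔ
    have hDm : L ^ 2 + 16 * π ^ 2 * (m : ℝ) ^ 2 ≠ 0 := by positivity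
    have hDn : L ^ 2 + 16 * π ^ 2 * (n : ℝ) ^ 2 ≠ 0 := by positivity
    have hDm' : 1 / 4 + (2 * π * (m : ℝ) / L) ^ 2 ≠ 0 := by positivity
    have hDn' : 1 / 4 + (2 * π * (n : ℝ) / L) ^ 2 ≠ 0 := by positivity
    have key : 2 * Real.sqrt (2 / L) * L ^ 2 * Δ / (L ^ 2 + 16 * π ^ 2 * (m : ℝ) ^ 2) *
          (2 * Real.sqrt (2 / L) * L ^ 2 * Δ / (L ^ 2 + 16 * π ^ 2 * (n : ℝ) ^ 2)) +
        2 * Real.sqrt (2 / L) * L ^ 2 * Δ / (L ^ 2 + 16 * π ^ 2 * (m : ℝ) ^ 2) *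
          (2 * Real.sqrt (2 / L) * L ^ 2 * Δ / (L ^ 2 + 16 * π ^ 2 * (n : ℝ) ^ 2)) =
        (Real.sqrt (2 / L) * Real.sqrt (2 / L)) *
          (8 * L ^ 4 * Δ ^ 2 / (L ^ 2 + 16 * π ^ 2 * (m : ℝ) ^ 2) / (L ^ 2 + 16 * π ^ 2 * (n : ℝ) ^ 2)) := by
      ring
    rw [key, Real.mul_self_sqrt (by positivity), hcosh, hΔ, Real.exp_neg]
    field_simp
    ring

/-- PROVED — ODD POLAR BLOCK IN RANK-ONE FORM: for `n, m < 0`,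
`∫ (ξ_m * ξ_n^*)(t)(e^{t/2} + e^{−t/2}) dt = −2 a_m^{(1/2)} a_n^{(1/2)}`, i.e. `w_{0,2}^- = −2 c_o c_oᵀ` with
`(c_o)_n = a_n^{(1/2)}` (closed form in `moment_neg_half`). [cite: ConnesConsani2023, §2.1.4, first sentence
("these terms contribute by a rank one matrix to both the odd and the even matrices `σ^±`"), p. 109] -/
theorem polarSum_odd_rankOne {L : ℝ} (hL : 0 < L) {n m : ℤ} (hn : n < 0) (hm : m < 0) :
    polarSum (xi L m ⋆ adj (xi L n)) = -(2 * moment L (1 / 2) m * moment L (1 / 2) n) := by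
  rw [polarSum_xi_conv, moment_neg_neg_half hL hn, moment_neg_neg_half hL hm, moment_neg_half hL hm,
    moment_neg_half hL hn]
  ring

/-! ## §8 Lemma 2.5 (i) and the EVEN table of Lemma 2.6 (iii): the convolutions `ξ_m * ξ_n^*` on `[0, L]`

For `0 ≤ y ≤ L` the convolution `(ξ_m * ξ_n^*)(y) = ∫_{y−L/2}^{L/2} ξ_m(x) ξ_n(x − y) dx` (Lemma 2.5 (i)), and for
`n, m ≥ 0` it is given by the table of Lemma 2.6 (iii) — the four formulas below are, branch by branch, the
definition of `Summit.RiemannHypothesis.RiemannHypothesis.Theorems.PfPersistence.thetaEven L n m y`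
(and of `ConnesX13.thetaEven`), so that the tree's TABLE-defined even test functions are the paper's convolutions.
The substitution `x = L/2 − s` removes the signs `(−1)^n` of the basis (`cos(nπ − u) = (−1)^n cos u`). -/

/-- PROVED (Lemma 2.5 (i)): for `0 ≤ y ≤ L`, `(ξ_m * ξ_n^*)(y) = ∫_{y−L/2}^{L/2} ξ_m(x) ξ_n(x − y) dx` (the integrand
vanishes unless `x ∈ [−L/2, L/2]` and `x − y ∈ [−L/2, L/2]`). [cite: ConnesConsani2023, Lemma 2.5 (i), p. 107] -/
theorem conv_xi_eq_intervalIntegral {L : ℝ} (m n : ℤ) {y : ℝ} (hy0 : 0 ≤ y) (hyL : y ≤ L) :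
    (xi L m ⋆ adj (xi L n)) y = ∫ x in (y - L / 2)..(L / 2), xiCore L m x * xiCore L n (x - y) := by
  rw [convolution_lsmul]
  have key : ∀ t, xi L m t • adj (xi L n) (y - t) =
      (Icc (y - L / 2) (L / 2)).indicator (fun t => xiCore L m t * xiCore L n (t - y)) t := by
    intro t
    simp only [smul_eq_mul, adj, neg_sub]
    by_cases h3 : t ∈ Icc (y - L / 2) (L / 2)
    · rw [Set.indicator_of_mem h3]
      have h1 : t ∈ Icc (-(L / 2)) (L / 2) := ⟨by linarith [h3.1], h3.2⟩
      have h2 : t - y ∈ Icc (-(L / 2)) (L / 2) := ⟨by linarith [h3.1], by linarith [h3.2]⟩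
      simp only [xi, Set.indicator_of_mem h1, Set.indicator_of_mem h2]
    · rw [Set.indicator_of_notMem h3]
      simp only [Set.mem_Icc, not_and_or, not_le] at h3
      rcases h3 with h3 | h3
      · have h2 : t - y ∉ Icc (-(L / 2)) (L / 2) := fun h => by linarith [h.1]
        simp [xi, Set.indicator_of_notMem h2]
      · have h1 : t ∉ Icc (-(L / 2)) (L / 2) := fun h => by linarith [h.2]
        simp [xi, Set.indicator_of_notMem h1]
  simp_rw [key]
  rw [MeasureTheory.integral_indicator measurableSet_Icc, integral_Icc_eq_integral_Ioc,
    intervalIntegral.integral_of_le (by linarith)]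

/-- PROVED: after `x = L/2 − s` the window integral runs over `s ∈ [0, L − y]`. [folklore] -/
private theorem window_integral_reflect (L y : ℝ) (g : ℝ → ℝ) :
    ∫ x in (y - L / 2)..(L / 2), g x = ∫ s in (0 : ℝ)..(L - y), g (L / 2 - s) := by
  rw [intervalIntegral.integral_comp_sub_left (fun x => g x) (L / 2)]
  simp only [sub_zero]
  rw [show L / 2 - (L - y) = y - L / 2 by ring]

/-- PROVED: `(−1)^m (−1)^m = 1`. [folklore] -/
private theorem neg_one_pow_mul_self' (m : ℕ) : (-1 : ℝ) ^ m * (-1 : ℝ) ^ m = 1 := by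
  rw [← mul_pow]; simp

/-- PROVED: `ξ_0^{core} = L^{-1/2}`. [folklore] -/
private theorem xiCore_zero (L x : ℝ) : xiCore L 0 x = 1 / Real.sqrt L := by
  simp [xiCore]

/-- PROVED: for `m > 0`, `ξ_m^{core}(L/2 − s) = (2/L)^{1/2} cos(2πms/L)` — the reflection absorbs `(−1)^m`.
[folklore] -/
private theorem xiCore_pos_reflect {L : ℝ} (hL : L ≠ 0) {m : ℕ} (hm : 0 < m) (s : ℝ) :
    xiCore L m (L / 2 - s) = Real.sqrt (2 / L) * Real.cos (2 * π * m * s / L) := by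
  have h0 : (m : ℤ) ≠ 0 := by exact_mod_cast hm.ne'
  have h1 : (0 : ℤ) < m := by exact_mod_cast hm
  simp only [xiCore, h0, h1, if_false, if_true, zpow_natCast, Int.cast_natCast]
  rw [show 2 * π * (m : ℝ) * (L / 2 - s) / L = m * π - 2 * π * m * s / L by field_simp,
    Real.cos_nat_mul_pi_sub]
  calc (-1 : ℝ) ^ m * Real.sqrt (2 / L) * ((-1 : ℝ) ^ m * Real.cos (2 * π * m * s / L))
      = ((-1 : ℝ) ^ m * (-1 : ℝ) ^ m) * (Real.sqrt (2 / L) * Real.cos (2 * π * m * s / L)) := by ring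
    _ = _ := by rw [neg_one_pow_mul_self', one_mul]

/-- PROVED: for `n > 0`, `ξ_n^{core}(L/2 − s − y) = (2/L)^{1/2} cos(2πn(s + y)/L)`. [folklore] -/
private theorem xiCore_pos_reflect_shift {L : ℝ} (hL : L ≠ 0) {n : ℕ} (hn : 0 < n) (s y : ℝ) :
    xiCore L n (L / 2 - s - y) = Real.sqrt (2 / L) * Real.cos (2 * π * n * (s + y) / L) := by
  rw [show L / 2 - s - y = L / 2 - (s + y) by ring, xiCore_pos_reflect hL hn]

/-- PROVED: `∫_a^b cos(kx + φ) dx = (sin(kb + φ) − sin(ka + φ))/k` for `k ≠ 0`. [folklore] -/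
private theorem integral_cos_linear (k φ a b : ℝ) (hk : k ≠ 0) :
    ∫ x in a..b, Real.cos (k * x + φ) = (Real.sin (k * b + φ) - Real.sin (k * a + φ)) / k := by
  have hd : ∀ x, HasDerivAt (fun x => Real.sin (k * x + φ) / k) (Real.cos (k * x + φ)) x := by
    intro x
    have h1 : HasDerivAt (fun x : ℝ => k * x + φ) k x := by
      simpa using ((hasDerivAt_id x).const_mul k).add_const φ
    refine (h1.sin.div_const k).congr_deriv ?_
    field_simp
  rw [integral_eq_sub_of_hasDerivAt (fun x _ => hd x) (by apply Continuous.intervalIntegrable; fun_prop)]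
  ring

/-- PROVED: `cos A cos B = (cos(A − B) + cos(A + B))/2`. [folklore] -/
private theorem cos_mul_cos' (A B : ℝ) :
    Real.cos A * Real.cos B = (Real.cos (A - B) + Real.cos (A + B)) / 2 := by
  rw [Real.cos_sub, Real.cos_add]; ring

/-- PROVED — Lemma 2.6 (iii), entry `n = m = 0`: `(ξ_0 * ξ_0^*)(y) = (L − y)/L` for `0 ≤ y ≤ L`
(= `thetaEven L 0 0 y`). [cite: ConnesConsani2023, Lemma 2.6 (iii) table, p. 109] -/
theorem conv_even_zero_zero {L : ℝ} (hL : 0 < L) {y : ℝ} (hy0 : 0 ≤ y) (hyL : y ≤ L) :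
    (xi L 0 ⋆ adj (xi L 0)) y = (L - y) / L := by
  have hsL : Real.sqrt L ≠ 0 := by positivity
  have hsLL : Real.sqrt L * Real.sqrt L = L := Real.mul_self_sqrt hL.le
  rw [conv_xi_eq_intervalIntegral 0 0 hy0 hyL]
  simp only [xiCore_zero, intervalIntegral.integral_const, smul_eq_mul]
  rw [show (1 / Real.sqrt L) * (1 / Real.sqrt L) = 1 / (Real.sqrt L * Real.sqrt L) by ring, hsLL]
  field_simp
  ring

/-- PROVED — Lemma 2.6 (iii), entries `m > 0`, `n = 0`: `(ξ_m * ξ_0^*)(y) = −sin(2πmy/L)/(√2 π m)` for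
`0 ≤ y ≤ L` (= `thetaEven L 0 m y`). [cite: ConnesConsani2023, Lemma 2.6 (iii) table, p. 109] -/
theorem conv_even_pos_zero {L : ℝ} (hL : 0 < L) {m : ℕ} (hm : 0 < m) {y : ℝ} (hy0 : 0 ≤ y) (hyL : y ≤ L) :
    (xi L m ⋆ adj (xi L 0)) y = -Real.sin (2 * π * m * y / L) / (Real.sqrt 2 * π * m) := by
  have hL0 : L ≠ 0 := hL.ne'
  have hmR : (0 : ℝ) < m := by exact_mod_cast hm
  have hsL : Real.sqrt L ≠ 0 := by positivity
  have hs2 : Real.sqrt 2 ≠ 0 := by positivity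
  have hsLL : Real.sqrt L * Real.sqrt L = L := Real.mul_self_sqrt hL.le
  have hs22 : Real.sqrt 2 * Real.sqrt 2 = 2 := Real.mul_self_sqrt (by norm_num)
  have hs2L : Real.sqrt (2 / L) = Real.sqrt 2 / Real.sqrt L := Real.sqrt_div' 2 hL.le
  rw [conv_xi_eq_intervalIntegral m 0 hy0 hyL, window_integral_reflect]
  have hpt : ∀ s, xiCore L m (L / 2 - s) * xiCore L 0 (L / 2 - s - y) =
      (Real.sqrt (2 / L) * (1 / Real.sqrt L)) * Real.cos (2 * π * m / L * s + 0) := fun s => by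
    rw [xiCore_pos_reflect hL0 hm, xiCore_zero, add_zero, show 2 * π * m / L * s = 2 * π * m * s / L by ring]
    ring
  simp_rw [hpt]
  rw [intervalIntegral.integral_const_mul, integral_cos_linear _ _ _ _ (by positivity), mul_zero, zero_add,
    add_zero, Real.sin_zero, sub_zero,
    show 2 * π * m / L * (L - y) = -(2 * π * m * y / L) + (m : ℕ) * (2 * π) by field_simp; ring,
    Real.sin_add_nat_mul_two_pi, Real.sin_neg, hs2L]
  field_simp
  rw [show Real.sqrt L ^ 2 = L from by rw [sq, hsLL], show Real.sqrt 2 ^ 2 = 2 from by rw [sq, hs22]]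
  ring

/-- PROVED — Lemma 2.6 (iii), entries `m = 0`, `n > 0`: `(ξ_0 * ξ_n^*)(y) = −sin(2πny/L)/(√2 π n)` for
`0 ≤ y ≤ L` (= `thetaEven L n 0 y`; with `conv_even_pos_zero` this is the symmetry `ξ_n * ξ_0^* = ξ_0 * ξ_n^*`).
[cite: ConnesConsani2023, Lemma 2.6 (iii) table, p. 109] -/
theorem conv_even_zero_pos {L : ℝ} (hL : 0 < L) {n : ℕ} (hn : 0 < n) {y : ℝ} (hy0 : 0 ≤ y) (hyL : y ≤ L) :
    (xi L 0 ⋆ adj (xi L n)) y = -Real.sin (2 * π * n * y / L) / (Real.sqrt 2 * π * n) := by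
  have hL0 : L ≠ 0 := hL.ne'
  have hnR : (0 : ℝ) < n := by exact_mod_cast hn
  have hsL : Real.sqrt L ≠ 0 := by positivity
  have hs2 : Real.sqrt 2 ≠ 0 := by positivity
  have hsLL : Real.sqrt L * Real.sqrt L = L := Real.mul_self_sqrt hL.le
  have hs22 : Real.sqrt 2 * Real.sqrt 2 = 2 := Real.mul_self_sqrt (by norm_num)
  have hs2L : Real.sqrt (2 / L) = Real.sqrt 2 / Real.sqrt L := Real.sqrt_div' 2 hL.le
  rw [conv_xi_eq_intervalIntegral 0 n hy0 hyL, window_integral_reflect]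
  have hpt : ∀ s, xiCore L 0 (L / 2 - s) * xiCore L n (L / 2 - s - y) =
      ((1 / Real.sqrt L) * Real.sqrt (2 / L)) * Real.cos (2 * π * n / L * s + 2 * π * n * y / L) := fun s => by
    rw [xiCore_pos_reflect_shift hL0 hn, xiCore_zero,
      show 2 * π * n / L * s + 2 * π * n * y / L = 2 * π * n * (s + y) / L by ring]
    ring
  simp_rw [hpt]
  rw [intervalIntegral.integral_const_mul, integral_cos_linear _ _ _ _ (by positivity), mul_zero, zero_add,
    show 2 * π * n / L * (L - y) + 2 * π * n * y / L = ((2 * n : ℕ) : ℝ) * π by push_cast; field_simp; ring,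
    Real.sin_nat_mul_pi, zero_sub, hs2L]
  field_simp
  rw [show Real.sqrt L ^ 2 = L from by rw [sq, hsLL], show Real.sqrt 2 ^ 2 = 2 from by rw [sq, hs22]]
  ring

/-- PROVED — Lemma 2.6 (iii), entries `m, n > 0`, `m ≠ n`:
`(ξ_m * ξ_n^*)(y) = (n sin(2πny/L) − m sin(2πmy/L))/(π(m² − n²))` for `0 ≤ y ≤ L` (= `thetaEven L n m y`).
[cite: ConnesConsani2023, Lemma 2.6 (iii) table, p. 109] -/
theorem conv_even_pos_pos_ne {L : ℝ} (hL : 0 < L) {m n : ℕ} (hm : 0 < m) (hn : 0 < n) (hmn : m ≠ n)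
    {y : ℝ} (hy0 : 0 ≤ y) (hyL : y ≤ L) :
    (xi L m ⋆ adj (xi L n)) y =
      ((n : ℝ) * Real.sin (2 * π * n * y / L) - (m : ℝ) * Real.sin (2 * π * m * y / L)) /
        (π * ((m : ℝ) ^ 2 - (n : ℝ) ^ 2)) := by
  have hL0 : L ≠ 0 := hL.ne'
  have hmR : (0 : ℝ) < m := by exact_mod_cast hm
  have hnR : (0 : ℝ) < n := by exact_mod_cast hn
  have hmn' : (m : ℝ) - n ≠ 0 := sub_ne_zero.mpr (by exact_mod_cast hmn)
  have hmn2 : (m : ℝ) + n ≠ 0 := by positivity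
  have hmn3 : (m : ℝ) ^ 2 - (n : ℝ) ^ 2 ≠ 0 := by
    rw [sq_sub_sq]; exact mul_ne_zero hmn2 hmn'
  have hk1 : 2 * π * ((m : ℝ) - n) / L ≠ 0 := by
    refine div_ne_zero (mul_ne_zero (by positivity) hmn') hL0
  have hk2 : 2 * π * ((m : ℝ) + n) / L ≠ 0 := by positivity
  have hs2L : Real.sqrt (2 / L) * Real.sqrt (2 / L) = 2 / L := Real.mul_self_sqrt (by positivity)
  rw [conv_xi_eq_intervalIntegral m n hy0 hyL, window_integral_reflect]
  have hpt : ∀ s, xiCore L m (L / 2 - s) * xiCore L n (L / 2 - s - y) =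
      (Real.sqrt (2 / L) * Real.sqrt (2 / L) / 2) *
        (Real.cos (2 * π * ((m : ℝ) - n) / L * s + -(2 * π * n * y / L)) +
          Real.cos (2 * π * ((m : ℝ) + n) / L * s + 2 * π * n * y / L)) := fun s => by
    rw [xiCore_pos_reflect hL0 hm, xiCore_pos_reflect_shift hL0 hn]
    have h := cos_mul_cos' (2 * π * m * s / L) (2 * π * n * (s + y) / L)
    rw [show 2 * π * (m : ℝ) * s / L - 2 * π * n * (s + y) / L = 2 * π * ((m : ℝ) - n) / L * s + -(2 * π * n * y / L) by ring,
      show 2 * π * (m : ℝ) * s / L + 2 * π * n * (s + y) / L = 2 * π * ((m : ℝ) + n) / L * s + 2 * π * n * y / L by ring] at h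
    linear_combination (Real.sqrt (2 / L) * Real.sqrt (2 / L)) * h
  simp_rw [hpt]
  rw [intervalIntegral.integral_const_mul,
    intervalIntegral.integral_add (by apply Continuous.intervalIntegrable; fun_prop)
      (by apply Continuous.intervalIntegrable; fun_prop),
    integral_cos_linear _ _ _ _ hk1, integral_cos_linear _ _ _ _ hk2, mul_zero, mul_zero, zero_add, zero_add,
    show 2 * π * ((m : ℝ) - n) / L * (L - y) + -(2 * π * n * y / L) =
      -(2 * π * m * y / L) + (((m : ℤ) - (n : ℤ) : ℤ) : ℝ) * (2 * π) by push_cast; field_simp; ring,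
    Real.sin_add_int_mul_two_pi,
    show 2 * π * ((m : ℝ) + n) / L * (L - y) + 2 * π * n * y / L =
      -(2 * π * m * y / L) + ((m + n : ℕ) : ℝ) * (2 * π) by push_cast; field_simp; ring,
    Real.sin_add_nat_mul_two_pi, Real.sin_neg, Real.sin_neg, hs2L]
  field_simp
  ring

/-- PROVED — Lemma 2.6 (iii), diagonal entries `m = n > 0`:
`(ξ_n * ξ_n^*)(y) = (L − y)cos(2πny/L)/L − sin(2πny/L)/(2πn)` for `0 ≤ y ≤ L` (= `thetaEven L n n y`).
[cite: ConnesConsani2023, Lemma 2.6 (iii) table, p. 109] -/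
theorem conv_even_diag {L : ℝ} (hL : 0 < L) {n : ℕ} (hn : 0 < n) {y : ℝ} (hy0 : 0 ≤ y) (hyL : y ≤ L) :
    (xi L n ⋆ adj (xi L n)) y =
      (L - y) / L * Real.cos (2 * π * n * y / L) - Real.sin (2 * π * n * y / L) / (2 * π * n) := by
  have hL0 : L ≠ 0 := hL.ne'
  have hnR : (0 : ℝ) < n := by exact_mod_cast hn
  have hk2 : 2 * π * ((n : ℝ) + n) / L ≠ 0 := by positivity
  have hs2L : Real.sqrt (2 / L) * Real.sqrt (2 / L) = 2 / L := Real.mul_self_sqrt (by positivity)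
  rw [conv_xi_eq_intervalIntegral n n hy0 hyL, window_integral_reflect]
  have hpt : ∀ s, xiCore L n (L / 2 - s) * xiCore L n (L / 2 - s - y) =
      (Real.sqrt (2 / L) * Real.sqrt (2 / L) / 2) * Real.cos (2 * π * n * y / L) +
        (Real.sqrt (2 / L) * Real.sqrt (2 / L) / 2) *
          Real.cos (2 * π * ((n : ℝ) + n) / L * s + 2 * π * n * y / L) := fun s => by
    rw [xiCore_pos_reflect hL0 hn, xiCore_pos_reflect_shift hL0 hn]
    have h := cos_mul_cos' (2 * π * n * s / L) (2 * π * n * (s + y) / L)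
    rw [show 2 * π * (n : ℝ) * s / L - 2 * π * n * (s + y) / L = -(2 * π * n * y / L) by ring, Real.cos_neg,
      show 2 * π * (n : ℝ) * s / L + 2 * π * n * (s + y) / L = 2 * π * ((n : ℝ) + n) / L * s + 2 * π * n * y / L by ring] at h
    linear_combination (Real.sqrt (2 / L) * Real.sqrt (2 / L)) * h
  simp_rw [hpt]
  rw [intervalIntegral.integral_add (by apply Continuous.intervalIntegrable; fun_prop)
      (by apply Continuous.intervalIntegrable; fun_prop),
    intervalIntegral.integral_const, smul_eq_mul, intervalIntegral.integral_const_mul,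
    integral_cos_linear _ _ _ _ hk2, mul_zero, zero_add,
    show 2 * π * ((n : ℝ) + n) / L * (L - y) + 2 * π * n * y / L =
      -(2 * π * n * y / L) + ((n + n : ℕ) : ℝ) * (2 * π) by push_cast; field_simp; ring,
    Real.sin_add_nat_mul_two_pi, Real.sin_neg, hs2L]
  field_simp
  ring

/-- PROVED — Lemma 2.6 (iii), the whole EVEN table in one statement: for `0 ≤ y ≤ L` and `n, m ≥ 0`,
`(ξ_m * ξ_n^*)(y)` equals the table entry, written with EXACTLY the case structure and formulas of the tree's
`Summit.RiemannHypothesis.RiemannHypothesis.Theorems.PfPersistence.thetaEven L n m y` (so that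
`thetaEven L n m y = (ξ_m * ξ_n^*)(y)` on `[0, L]` is `by rw [thetaEven]; exact (conv_even_table …).symm` for a prover).
[cite: ConnesConsani2023, Lemma 2.6 (iii) table, p. 109] -/
theorem conv_even_table {L : ℝ} (hL : 0 < L) (n m : ℕ) {y : ℝ} (hy0 : 0 ≤ y) (hyL : y ≤ L) :
    (xi L m ⋆ adj (xi L n)) y =
      (if n = 0 ∧ m = 0 then (L - y) / L
      else if n = 0 then -Real.sin (2 * π * m * y / L) / (Real.sqrt 2 * π * m)
      else if m = 0 then -Real.sin (2 * π * n * y / L) / (Real.sqrt 2 * π * n)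
      else if n = m then (L - y) / L * Real.cos (2 * π * n * y / L) - Real.sin (2 * π * n * y / L) / (2 * π * n)
      else ((n : ℝ) * Real.sin (2 * π * n * y / L) - (m : ℝ) * Real.sin (2 * π * m * y / L)) /
        (π * ((m : ℝ) ^ 2 - (n : ℝ) ^ 2))) := by
  split_ifs with h1 h2 h3 h4
  · obtain ⟨rfl, rfl⟩ := h1
    exact_mod_cast conv_even_zero_zero hL hy0 hyL
  · subst h2
    have hm : 0 < m := Nat.pos_of_ne_zero (fun h => h1 ⟨rfl, h⟩)
    exact_mod_cast conv_even_pos_zero hL hm hy0 hyL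
  · subst h3
    exact_mod_cast conv_even_zero_pos hL (Nat.pos_of_ne_zero h2) hy0 hyL
  · subst h4
    exact_mod_cast conv_even_diag hL (Nat.pos_of_ne_zero h2) hy0 hyL
  · exact conv_even_pos_pos_ne hL (Nat.pos_of_ne_zero h3) (Nat.pos_of_ne_zero h2) (Ne.symm h4) hy0 hyL

/-! ## §9 Lemma 2.5 (ii)–(iii), Lemma 2.6 (ii) (even ⟂ odd) and the ODD table of Lemma 2.6 (iii)

The odd modes are `ξ_{−p}`, `p ≥ 1`. The tree's `PfPersistence.thetaOdd L n m y` (indices `n, m ≥ 1` standing for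
`ξ⁻_n = (−1)^n (2/L)^{1/2} sin(2πnx/L) = −ξ_{−n}`, file `PfPersistenceParityTransfer.lean`) and `ConnesX13.thetaOdd` are
the printed `m, n < 0` rows; `conv_odd_table` below has exactly the case structure of the former
(`thetaOdd L n m y = (ξ_{−m} * ξ_{−n}^*)(y)` on `[0, L]`; the two sign flips cancel). -/

/-- PROVED: commutativity of the real convolution on `ℝ` (no integrability needed). [folklore] -/
private theorem conv_comm (f g : ℝ → ℝ) : f ⋆ g = g ⋆ f := by
  funext x
  rw [convolution_lsmul, convolution_lsmul]
  simp only [smul_eq_mul]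
  have h := integral_sub_left_eq_self (fun t => f t * g (x - t)) volume x
  simp only [sub_sub_cancel] at h
  rw [← h]
  congr 1
  funext t
  ring

/-- PROVED (Lemma 2.5 (ii)): for real `φ₁, φ₂`, `(φ₁ * φ₂^*)(−t) = (φ₂ * φ₁^*)(t)`.
[cite: ConnesConsani2023, Lemma 2.5 (ii), p. 107] -/
theorem conv_adj_neg (φ₁ φ₂ : ℝ → ℝ) (t : ℝ) : (φ₁ ⋆ adj φ₂) (-t) = (φ₂ ⋆ adj φ₁) t := by
  rw [convolution_lsmul, convolution_lsmul]
  simp only [adj, smul_eq_mul, neg_sub, sub_neg_eq_add]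
  have h := integral_add_right_eq_self (μ := (volume : Measure ℝ)) (fun x => φ₂ x * φ₁ (x - t)) t
  simp only [add_sub_cancel_right] at h
  rw [← h]
  congr 1
  funext x
  ring_nf

/-- PROVED (Lemma 2.5 (iii)): for real `φ₁` even and `φ₂` odd, `φ₁ * φ₂^* + φ₂ * φ₁^* = 0` identically (no
integrability needed: `φ₂^* = −φ₂`, `φ₁^* = φ₁`, and the convolution is commutative).
[cite: ConnesConsani2023, Lemma 2.5 (iii), p. 107] -/
theorem conv_adj_add_eq_zero_of_even_odd {φ₁ φ₂ : ℝ → ℝ} (h₁ : ∀ x, φ₁ (-x) = φ₁ x)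
    (h₂ : ∀ x, φ₂ (-x) = -φ₂ x) (t : ℝ) : (φ₁ ⋆ adj φ₂) t + (φ₂ ⋆ adj φ₁) t = 0 := by
  have ha1 : adj φ₁ = φ₁ := funext fun x => h₁ x
  have ha2 : adj φ₂ = fun x => -φ₂ x := funext fun x => h₂ x
  rw [ha1, ha2, conv_comm φ₂ φ₁, convolution_lsmul, convolution_lsmul]
  simp only [smul_eq_mul, mul_neg, MeasureTheory.integral_neg, neg_add_cancel]

/-- PROVED: `ξ_n` is even for `n ≥ 0` (constant and cosine modes on a symmetric window). [folklore] -/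
private theorem xi_neg_of_nonneg (L : ℝ) {n : ℤ} (hn : 0 ≤ n) (x : ℝ) : xi L n (-x) = xi L n x := by
  have hmem : (-x ∈ Icc (-(L / 2)) (L / 2)) ↔ (x ∈ Icc (-(L / 2)) (L / 2)) := by
    simp only [Set.mem_Icc]; constructor <;> rintro ⟨h1, h2⟩ <;> constructor <;> linarith
  unfold xi
  by_cases hx : x ∈ Icc (-(L / 2)) (L / 2)
  · rw [Set.indicator_of_mem hx, Set.indicator_of_mem (hmem.mpr hx)]
    rcases eq_or_lt_of_le hn with h0 | hpos
    · subst h0; simp [xiCore]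
    · simp only [xiCore, hpos.ne', hpos, if_false, if_true, mul_neg, neg_div, Real.cos_neg]
  · rw [Set.indicator_of_notMem hx, Set.indicator_of_notMem (fun h => hx (hmem.mp h))]

/-- PROVED: `ξ_n` is odd for `n < 0` (sine modes on a symmetric window). [folklore] -/
private theorem xi_neg_of_neg (L : ℝ) {n : ℤ} (hn : n < 0) (x : ℝ) : xi L n (-x) = -xi L n x := by
  have hmem : (-x ∈ Icc (-(L / 2)) (L / 2)) ↔ (x ∈ Icc (-(L / 2)) (L / 2)) := by
    simp only [Set.mem_Icc]; constructor <;> rintro ⟨h1, h2⟩ <;> constructor <;> linarith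
  unfold xi
  by_cases hx : x ∈ Icc (-(L / 2)) (L / 2)
  · rw [Set.indicator_of_mem hx, Set.indicator_of_mem (hmem.mpr hx)]
    simp only [xiCore, hn.ne, not_lt.mpr hn.le, if_false, mul_neg, neg_div, Real.sin_neg]
  · rw [Set.indicator_of_notMem hx, Set.indicator_of_notMem (fun h => hx (hmem.mp h)), neg_zero]

/-- PROVED (Lemma 2.6 (ii)): for `n ≥ 0 > m`, `(ξ_n * ξ_m^* + ξ_m * ξ_n^*)(y) = 0` for all `y` — the Weil matrix splits
as `σ = σ^+ ⊕ σ^-`. [cite: ConnesConsani2023, Lemma 2.6 (ii), p. 108] -/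
theorem conv_even_odd_symm_eq_zero (L : ℝ) {n m : ℤ} (hn : 0 ≤ n) (hm : m < 0) (y : ℝ) :
    (xi L n ⋆ adj (xi L m)) y + (xi L m ⋆ adj (xi L n)) y = 0 :=
  conv_adj_add_eq_zero_of_even_odd (xi_neg_of_nonneg L hn) (xi_neg_of_neg L hm) y

/-- PROVED: for `p > 0`, `ξ_{−p}^{core}(L/2 − s) = (2/L)^{1/2} sin(2πps/L)` — the reflection absorbs the sign. [folklore] -/
private theorem xiCore_negIdx_reflect {L : ℝ} (hL : L ≠ 0) {p : ℕ} (hp : 0 < p) (s : ℝ) :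
    xiCore L (-(p : ℤ)) (L / 2 - s) = Real.sqrt (2 / L) * Real.sin (2 * π * p * s / L) := by
  have h0 : (-(p : ℤ)) ≠ 0 := by omega
  have h1 : ¬ (0 : ℤ) < -(p : ℤ) := by omega
  have hinv : ((-1 : ℝ) ^ p)⁻¹ = (-1 : ℝ) ^ p := inv_eq_of_mul_eq_one_right (neg_one_pow_mul_self' p)
  simp only [xiCore, h0, h1, if_false, zpow_neg, zpow_natCast, hinv, Int.cast_neg, Int.cast_natCast]
  rw [show 2 * π * (-(p : ℝ)) * (L / 2 - s) / L = -(p * π - 2 * π * p * s / L) by field_simp,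
    Real.sin_neg, Real.sin_nat_mul_pi_sub, neg_neg]
  calc (-1 : ℝ) ^ p * Real.sqrt (2 / L) * ((-1 : ℝ) ^ p * Real.sin (2 * π * p * s / L))
      = ((-1 : ℝ) ^ p * (-1 : ℝ) ^ p) * (Real.sqrt (2 / L) * Real.sin (2 * π * p * s / L)) := by ring
    _ = _ := by rw [neg_one_pow_mul_self', one_mul]

/-- PROVED: shifted version of `xiCore_negIdx_reflect`. [folklore] -/
private theorem xiCore_negIdx_reflect_shift {L : ℝ} (hL : L ≠ 0) {q : ℕ} (hq : 0 < q) (s y : ℝ) :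
    xiCore L (-(q : ℤ)) (L / 2 - s - y) = Real.sqrt (2 / L) * Real.sin (2 * π * q * (s + y) / L) := by
  rw [show L / 2 - s - y = L / 2 - (s + y) by ring, xiCore_negIdx_reflect hL hq]

/-- PROVED: `sin A sin B = (cos(A − B) − cos(A + B))/2`. [folklore] -/
private theorem sin_mul_sin' (A B : ℝ) :
    Real.sin A * Real.sin B = (Real.cos (A - B) - Real.cos (A + B)) / 2 := by
  rw [Real.cos_sub, Real.cos_add]; ring

/-- PROVED — Lemma 2.6 (iii), ODD rows `m, n < 0`, `m ≠ n` (written with `m = −p`, `n = −q`, `p, q ≥ 1`):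
`(ξ_{−p} * ξ_{−q}^*)(y) = (p sin(2πqy/L) − q sin(2πpy/L))/(π(p² − q²))` for `0 ≤ y ≤ L`
(= printed `(m sin(2πny/L) − n sin(2πmy/L))/(π(m² − n²))`; = `thetaOdd L q p y`).
[cite: ConnesConsani2023, Lemma 2.6 (iii) table, p. 109] -/
theorem conv_odd_ne {L : ℝ} (hL : 0 < L) {p q : ℕ} (hp : 0 < p) (hq : 0 < q) (hpq : p ≠ q)
    {y : ℝ} (hy0 : 0 ≤ y) (hyL : y ≤ L) :
    (xi L (-(p : ℤ)) ⋆ adj (xi L (-(q : ℤ)))) y =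
      ((p : ℝ) * Real.sin (2 * π * q * y / L) - (q : ℝ) * Real.sin (2 * π * p * y / L)) /
        (π * ((p : ℝ) ^ 2 - (q : ℝ) ^ 2)) := by
  have hL0 : L ≠ 0 := hL.ne'
  have hpR : (0 : ℝ) < p := by exact_mod_cast hp
  have hqR : (0 : ℝ) < q := by exact_mod_cast hq
  have hpq' : (p : ℝ) - q ≠ 0 := sub_ne_zero.mpr (by exact_mod_cast hpq)
  have hpq2 : (p : ℝ) + q ≠ 0 := by positivity
  have hpq3 : (p : ℝ) ^ 2 - (q : ℝ) ^ 2 ≠ 0 := by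
    rw [sq_sub_sq]; exact mul_ne_zero hpq2 hpq'
  have hk1 : 2 * π * ((p : ℝ) - q) / L ≠ 0 := by
    refine div_ne_zero (mul_ne_zero (by positivity) hpq') hL0
  have hk2 : 2 * π * ((p : ℝ) + q) / L ≠ 0 := by positivity
  have hs2L : Real.sqrt (2 / L) * Real.sqrt (2 / L) = 2 / L := Real.mul_self_sqrt (by positivity)
  rw [conv_xi_eq_intervalIntegral _ _ hy0 hyL, window_integral_reflect]
  have hpt : ∀ s, xiCore L (-(p : ℤ)) (L / 2 - s) * xiCore L (-(q : ℤ)) (L / 2 - s - y) =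
      (Real.sqrt (2 / L) * Real.sqrt (2 / L) / 2) *
        (Real.cos (2 * π * ((p : ℝ) - q) / L * s + -(2 * π * q * y / L)) -
          Real.cos (2 * π * ((p : ℝ) + q) / L * s + 2 * π * q * y / L)) := fun s => by
    rw [xiCore_negIdx_reflect hL0 hp, xiCore_negIdx_reflect_shift hL0 hq]
    have h := sin_mul_sin' (2 * π * p * s / L) (2 * π * q * (s + y) / L)
    rw [show 2 * π * (p : ℝ) * s / L - 2 * π * q * (s + y) / L = 2 * π * ((p : ℝ) - q) / L * s + -(2 * π * q * y / L) by ring,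
      show 2 * π * (p : ℝ) * s / L + 2 * π * q * (s + y) / L = 2 * π * ((p : ℝ) + q) / L * s + 2 * π * q * y / L by ring] at h
    linear_combination (Real.sqrt (2 / L) * Real.sqrt (2 / L)) * h
  simp_rw [hpt]
  rw [intervalIntegral.integral_const_mul,
    intervalIntegral.integral_sub (by apply Continuous.intervalIntegrable; fun_prop)
      (by apply Continuous.intervalIntegrable; fun_prop),
    integral_cos_linear _ _ _ _ hk1, integral_cos_linear _ _ _ _ hk2, mul_zero, mul_zero, zero_add, zero_add,
    show 2 * π * ((p : ℝ) - q) / L * (L - y) + -(2 * π * q * y / L) =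
      -(2 * π * p * y / L) + (((p : ℤ) - (q : ℤ) : ℤ) : ℝ) * (2 * π) by push_cast; field_simp; ring,
    Real.sin_add_int_mul_two_pi,
    show 2 * π * ((p : ℝ) + q) / L * (L - y) + 2 * π * q * y / L =
      -(2 * π * p * y / L) + ((p + q : ℕ) : ℝ) * (2 * π) by push_cast; field_simp; ring,
    Real.sin_add_nat_mul_two_pi, Real.sin_neg, Real.sin_neg, hs2L]
  field_simp
  ring

/-- PROVED — Lemma 2.6 (iii), ODD diagonal `m = n < 0` (`n = −p`, `p ≥ 1`):
`(ξ_{−p} * ξ_{−p}^*)(y) = (L − y)cos(2πpy/L)/L + sin(2πpy/L)/(2πp)` for `0 ≤ y ≤ L` (= `thetaOdd L p p y`).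
[cite: ConnesConsani2023, Lemma 2.6 (iii) table, p. 109] -/
theorem conv_odd_diag {L : ℝ} (hL : 0 < L) {p : ℕ} (hp : 0 < p) {y : ℝ} (hy0 : 0 ≤ y) (hyL : y ≤ L) :
    (xi L (-(p : ℤ)) ⋆ adj (xi L (-(p : ℤ)))) y =
      (L - y) / L * Real.cos (2 * π * p * y / L) + Real.sin (2 * π * p * y / L) / (2 * π * p) := by
  have hL0 : L ≠ 0 := hL.ne'
  have hpR : (0 : ℝ) < p := by exact_mod_cast hp
  have hk2 : 2 * π * ((p : ℝ) + p) / L ≠ 0 := by positivity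
  have hs2L : Real.sqrt (2 / L) * Real.sqrt (2 / L) = 2 / L := Real.mul_self_sqrt (by positivity)
  rw [conv_xi_eq_intervalIntegral _ _ hy0 hyL, window_integral_reflect]
  have hpt : ∀ s, xiCore L (-(p : ℤ)) (L / 2 - s) * xiCore L (-(p : ℤ)) (L / 2 - s - y) =
      (Real.sqrt (2 / L) * Real.sqrt (2 / L) / 2) * Real.cos (2 * π * p * y / L) -
        (Real.sqrt (2 / L) * Real.sqrt (2 / L) / 2) *
          Real.cos (2 * π * ((p : ℝ) + p) / L * s + 2 * π * p * y / L) := fun s => by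
    rw [xiCore_negIdx_reflect hL0 hp, xiCore_negIdx_reflect_shift hL0 hp]
    have h := sin_mul_sin' (2 * π * p * s / L) (2 * π * p * (s + y) / L)
    rw [show 2 * π * (p : ℝ) * s / L - 2 * π * p * (s + y) / L = -(2 * π * p * y / L) by ring, Real.cos_neg,
      show 2 * π * (p : ℝ) * s / L + 2 * π * p * (s + y) / L = 2 * π * ((p : ℝ) + p) / L * s + 2 * π * p * y / L by ring] at h
    linear_combination (Real.sqrt (2 / L) * Real.sqrt (2 / L)) * h
  simp_rw [hpt]
  rw [intervalIntegral.integral_sub (by apply Continuous.intervalIntegrable; fun_prop)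
      (by apply Continuous.intervalIntegrable; fun_prop),
    intervalIntegral.integral_const, smul_eq_mul, intervalIntegral.integral_const_mul,
    integral_cos_linear _ _ _ _ hk2, mul_zero, zero_add,
    show 2 * π * ((p : ℝ) + p) / L * (L - y) + 2 * π * p * y / L =
      -(2 * π * p * y / L) + ((p + p : ℕ) : ℝ) * (2 * π) by push_cast; field_simp; ring,
    Real.sin_add_nat_mul_two_pi, Real.sin_neg, hs2L]
  field_simp
  ring

/-- PROVED — Lemma 2.6 (iii), the whole ODD table in one statement: for `0 ≤ y ≤ L` and `n, m ≥ 1`,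
`(ξ_{−m} * ξ_{−n}^*)(y)` equals the printed entry, written with EXACTLY the case structure and formulas of the tree's
`Summit.RiemannHypothesis.RiemannHypothesis.Theorems.PfPersistence.thetaOdd L n m y` (`PfPersistenceParityTransfer.lean`;
`ConnesX13.thetaOdd p q y` is the same up to the order of the two diagonal summands).
[cite: ConnesConsani2023, Lemma 2.6 (iii) table, p. 109] -/
theorem conv_odd_table {L : ℝ} (hL : 0 < L) {n m : ℕ} (hn : 0 < n) (hm : 0 < m) {y : ℝ} (hy0 : 0 ≤ y)
    (hyL : y ≤ L) :
    (xi L (-(m : ℤ)) ⋆ adj (xi L (-(n : ℤ)))) y =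
      (if n = m then (L - y) / L * Real.cos (2 * π * n * y / L) + Real.sin (2 * π * n * y / L) / (2 * π * n)
      else ((m : ℝ) * Real.sin (2 * π * n * y / L) - (n : ℝ) * Real.sin (2 * π * m * y / L)) /
        (π * ((m : ℝ) ^ 2 - (n : ℝ) ^ 2))) := by
  split_ifs with h
  · subst h
    exact conv_odd_diag hL hn hy0 hyL
  · exact conv_odd_ne hL hm hn (Ne.symm h) hy0 hyL

end SemilocalTrigBasis

end Literature.NumberTheory.LFunctions
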